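import Summits.QuantumAdvantage.QuantumAdvantage.Theorems.MobiusLadderLiouvilleOrthogonalTC0HypZero
import Summits.QuantumAdvantage.QuantumAdvantage.Theorems.MobiusLadderLiouvilleOrthogonalTC0StubTransferPos
import Summits.QuantumAdvantage.QuantumAdvantage.Theorems.MobiusLadderLiouvilleOrthogonalAC0
import Summits.QuantumAdvantage.QuantumAdvantage.Theorems.MobiusLadderLiouvilleOrthogonalTC0StubLtfCore
import Summits.QuantumAdvantage.QuantumAdvantage.Theorems.MobiusLadderLiouvilleOrthogonalTC0StubDepthOneLtf
import Summits.QuantumAdvantage.QuantumAdvantage.Theorems.MobiusLadderLiouvilleOrthogonalTC0StubLtfInfluence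
import Summits.QuantumAdvantage.QuantumAdvantage.Theorems.MobiusLadderLiouvilleOrthogonalTC0StubPeresTail
import Summits.QuantumAdvantage.QuantumAdvantage.Theorems.MobiusLadderLiouvilleOrthogonalTC0Spectral
import Summits.QuantumAdvantage.QuantumAdvantage.Theorems.MobiusLadderLiouvilleOrthogonalTC0SensLtf
import Summits.QuantumAdvantage.QuantumAdvantage.Theorems.MobiusLadderLiouvilleOrthogonalTC0DepthOne
import Summits.QuantumAdvantage.QuantumAdvantage.Theorems.MobiusLadderLiouvilleOrthogonalTC0StubSizeKSens
import Summits.QuantumAdvantage.QuantumAdvantage.Theorems.MobiusLadderLiouvilleOrthogonalTC0StubSmallMajSim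
import Summits.QuantumAdvantage.QuantumAdvantage.Theorems.MobiusLadderLiouvilleOrthogonalTC0LtfCombinationPoly
import Summits.QuantumAdvantage.QuantumAdvantage.Theorems.MobiusLadderLiouvilleOrthogonalTC0StubKaneClaim
import Summits.QuantumAdvantage.QuantumAdvantage.Theorems.MobiusLadderLiouvilleOrthogonalTC0StubCubeTail
import Summits.QuantumAdvantage.QuantumAdvantage.Theorems.MobiusLadderLiouvilleOrthogonalTC0StubLevelOne
import Summits.QuantumAdvantage.QuantumAdvantage.Theorems.MobiusLadderLiouvilleOrthogonalTC0StubDepthTwoNf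
import Summits.QuantumAdvantage.QuantumAdvantage.Theorems.MobiusLadderLiouvilleOrthogonalTC0StubOrLtfTranslate
import Summits.QuantumAdvantage.QuantumAdvantage.Theorems.MobiusLadderLiouvilleOrthogonalTC0StubKaneSens
import Summits.QuantumAdvantage.QuantumAdvantage.Theorems.MobiusLadderLiouvilleOrthogonalTC0OrLtf
import Summits.QuantumAdvantage.QuantumAdvantage.Theorems.MobiusLadderLiouvilleOrthogonalTC0DepthTwoOrNf
import Summits.QuantumAdvantage.QuantumAdvantage.Theorems.MobiusLadderLiouvilleOrthogonalTC0StubConstSubst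
import Summits.QuantumAdvantage.QuantumAdvantage.Theorems.MobiusLadderLiouvilleOrthogonalTC0StubConstSubst3
import Summits.QuantumAdvantage.QuantumAdvantage.Theorems.MobiusLadderLiouvilleOrthogonalTC0StubBlockInfluence
import Summits.QuantumAdvantage.QuantumAdvantage.Theorems.MobiusLadderLiouvilleOrthogonalTC0StubAcInfluence
import Summits.QuantumAdvantage.QuantumAdvantage.Theorems.MobiusLadderLiouvilleOrthogonalTC0FewMaj
import Summits.QuantumAdvantage.QuantumAdvantage.Theorems.MobiusLadderLiouvilleOrthogonalTC0StubPhaseTail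
import Summits.QuantumAdvantage.QuantumAdvantage.Theorems.MobiusLadderLiouvilleOrthogonalTC0StubGelfondSmall
import Summits.QuantumAdvantage.QuantumAdvantage.Theorems.MobiusLadderLiouvilleOrthogonalTC0StubSliceL2
import Summits.QuantumAdvantage.QuantumAdvantage.Theorems.MobiusLadderLiouvilleOrthogonalTC0StubSliceTail
import Summits.QuantumAdvantage.QuantumAdvantage.Theorems.MobiusLadderLiouvilleOrthogonalTC0StubSliceCriterion
import Summits.QuantumAdvantage.QuantumAdvantage.Theorems.MobiusLadderLiouvilleOrthogonalTC0StubSymmetricRung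
import Summits.QuantumAdvantage.QuantumAdvantage.Theorems.MobiusLadderLiouvilleOrthogonalTC0SymmetricDigital
import Summits.QuantumAdvantage.QuantumAdvantage.Theorems.MobiusLadderLiouvilleOrthogonalTC0MoebiusBridge
import Literature.Computability.Complexity.ACFourierTails
import Summits.QuantumAdvantage.QuantumAdvantage.Theorems.MobiusLadderLiouvilleOrthogonalTC0FewMajSens3
import Summits.QuantumAdvantage.QuantumAdvantage.Theorems.MobiusLadderDigitPolyUniformityLiouvilleAutomatic
import Literature.NumberTheory.Sieve.ParityWave0MatomakiRadziwillHolds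
import Literature.NumberTheory.LFunctions.AutomaticSequenceAutomata
import Summits.QuantumAdvantage.QuantumAdvantage.Theorems.MobiusLadderLiouvilleOrthogonalTC0StubWindowAverage
import Summits.QuantumAdvantage.QuantumAdvantage.Theorems.MobiusLadderLiouvilleOrthogonalTC0StubAlignedBlocks
import Summits.QuantumAdvantage.QuantumAdvantage.Theorems.MobiusLadderLiouvilleOrthogonalTC0StubTopDigits
import Summits.QuantumAdvantage.QuantumAdvantage.Theorems.MobiusLadderLiouvilleOrthogonalTC0StubAutomaticFamily
import Summits.QuantumAdvantage.QuantumAdvantage.Theorems.MobiusLadderLiouvilleOrthogonalTC0StubScanRung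
import Summits.QuantumAdvantage.QuantumAdvantage.Theorems.MobiusLadderLiouvilleOrthogonalTC0StubWaist
import Summits.QuantumAdvantage.QuantumAdvantage.Theorems.MobiusLadderLiouvilleOrthogonalTC0StubEndsSqrt
import Literature.Computability.Complexity.FourierDegree

/-!
# `LiouvilleOrthogonalTC0` (stmt-QuantumAdvantage-1393) — line `Sketch` (card
`multiplicative-xor-ladder`): reduction skeleton v9 (continuation lead
`prover-line-stmt-QuantumAdvantage-1393-c6-0`; v8 by `…-c5-0`; v6/v7 by `…-c3-0` / `-c4-0`; v4/v5 by `…-c2-0`)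

Crux `Summit.QuantumAdvantage.QuantumAdvantage.Theses.MobiusLadder.LiouvilleOrthogonalTC0` (route
`MobiusLadder`, rank 5, breakthrough-type): for every depth `d`, size polynomial `p` and `ε > 0`,
eventually in `n`, every circuit `C` on the `n` binary digits over `tcBasis` with `acDepth ≤ d`,
`size ≤ p(n)` has `|Σ_{N<2ⁿ} λ(N)·sgn C(bits N)| ≤ ε 2ⁿ`.

THE LINE (composition idea unchanged since v1). `λ` is completely multiplicative and
multiplication by a constant is a `TC⁰` map, so Impagliazzo hard-core + Yao XOR run INSIDE `TC⁰`
along the prime-interval factorisation of a uniform `N < 2ⁿ`: CONSTANT-ERROR hardness of `Ω mod 2`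
on prime-window pieces (`LocalPieceHardness`, `Theorems/MobiusLadderLiouvilleOrthogonalTC0Defs.lean`)
gives the full `ε`-law of the crux. v1/v2 (lead `…-1393-0`) landed the whole transfer (13 supports
files + `stub_transfer`, p121723); v3 (lead `…-1393-c1-0`) found the registered hypothesis false at
the degenerate exponent `A = 0` (`not_localPieceHardness_zero`, p123292), repaired it to `A ≥ 1`
(`stub_hyp_pos`) and re-landed the transfer (`stub_transfer_pos`, p123356).

RESHAPE v4 (this lead). The single open stub `stub_hyp_pos` is honestly crux-sized (an average-case
`TC⁰` lower bound for a factoring-type function). v4 makes the composition CASE-SPLIT on the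
circuit, so that the open hypothesis is invoked only where nothing else is known, and EARNS the
first threshold rung unconditionally:

* circuits of `acDepth ≤ 1` over `tcBasis` — a single `∧/∨/MAJ` gate of literals under free
  negations, i.e. an INTEGER LINEAR THRESHOLD FUNCTION of the digits (`stub_depthOne_ltf`) — are
  handled by `stub_depthOne` (PROVED in v4 from the tree's Bourgain Möbius–Walsh bound for `λ`,
  `Literature.NumberTheory.Sieve.bourgain_liouville_walsh_holds`, and PERES' noise-stability theorem
  for threshold functions in Fourier-tail form, `stub_peresTail` ← `stub_ltfInfluence`): this is the
  `λ`-form of the "single majority/threshold gate" case of Kalai's `TC⁰` conjecture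
  (`Literature.NumberTheory.LFunctions.kalai_moebius_TC0`: "the single-gate case … is covered by
  Bourgain's monotone corollary; depth ≥ 2 is open"), for UNATE gates (negated literals allowed);
* circuits over `acBasis` (no `MAJ` gate) of any depth — the tree's PROVED
  `Theorems.LiouvilleOrthogonalAC0_proof` (Green 2012);
* the rest (depth `≥ 2` with a majority gate) — `stub_transfer_pos` from `stub_hyp_pos` (OPEN).

RESHAPE v5 (this lead, cycle 2). A fourth case of the composition is earned unconditionally: CONSTANT
size polynomials `p` (any depth `d`) — a circuit over `tcBasis` with `≤ K` gates has block sensitivity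
`≤ 3^K · 2ⁿ√m` for every `m`-partition of the inputs (`stub_sizeK_sens`), hence Fourier tail
`≤ 3^{K+1}/√m` (`stub_tailOfSens`, Peres' conclusion with a constant; `stub_sensLtf`, block
sensitivity of threshold functions), hence `λ`-orthogonality by the spectral criterion
`stub_spectral` (LANDED p125112) — glue `stub_sizeLe` (LANDED p126208). A fifth case: every
majority gate `MAJₖ` of `C` has `2^k ≤ n^d` (fan-in `≤ d log₂ n`, "for instance") — such gates are
depth-two `AC⁰` gadgets (`stub_smallMajSim`, LANDED p126099), so the `AC⁰` rung at depth `2d` applies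
(`stub_smallMaj`, LANDED p126211). Further unconditional rungs landed as supports (not needed by the
composition): log-size circuits (`…LogSize`, p126247), juntas on `≤ n^α` digits (`…Junta`, p126064),
Boolean combinations of `K` / `≤ n^α` threshold tests (`…LtfCombination(Poly)`, p126101/p126215),
the spectral criteria (`…Spectral`, `…SpectralLevel`, p125112/p125447).

RESHAPE v6 (designed independently by leads `…-c3-0` and `…-c4-0`; registered by c3, BUILT AND LANDED by
c4 and its wave). The depth-two `∧/∨`-top rung is earned unconditionally: `λ` is orthogonal to every
`AND/OR` of polynomially many integer linear threshold tests of the digits (intersections / unions of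
`poly(n)` halfspaces), from D. M. Kane, *The average sensitivity of an intersection of half spaces*
(STOC 2014, arXiv:1309.2987), Proposition 3 — the average sensitivity of an `OR` of `k` UNATE functions
of `m` Boolean variables is `O(√(m log k))` — proved here in counting form (`stub_kaneClaim` = Kane's
one-step inequality, LANDED p127560; `stub_cubeTail` = the Hoeffding count on the cube, LANDED p127309;
`stub_levelOne` = Kane's Lemma 6, LANDED p127663; `stub_kaneSens` = the telescoping sum with the crude
uniform level `y = √(2m log((K+1)(m+1)))`, LANDED p128206) and fed to the v5 engine: block translates of
an `OR` of threshold tests are `OR`s of unate functions (`stub_orLtf_translate`, LANDED p127574), so the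
block sensitivity is `≤ (4√log((K+1)(m+1)) + 8)·2ⁿ√m` for every `m`-partition, the Fourier tail above
the level `⌊n^{1/R}⌋₊ + 1` is `O(√(log n)·n^{-1/(2R)}) → 0` (`stub_tailOfSens`), and the single-level
spectral criterion applies (`stub_orLtf` = `liouville_orthogonal_orLtf`, with `liouville_orthogonal_andLtf`,
LANDED p128558). With the depth-two normal forms `stub_depthTwo_nf` (LANDED p127876: up to a free
negation, an `acDepth ≤ 2` circuit over `tcBasis` is either an `OR` of `≤ size + n` integer tests or a
MAJORITY with multiplicities of `≤ size + n` such tests) and `stub_depthTwoOrNf` (LANDED p128546: the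
OR-form is forced by the SYNTACTIC condition "every majority gate at `acWeight`-depth `≤ 1`"), and the
landed `LtfCombinationPoly` rung (`≤ n^α` tests under ANY Boolean function), the composition now sends to
the open hypothesis only: depth-two circuits under a majority of MORE than `n^α` distinct threshold
gates (`MAJ ∘ THR` with large top fan-in), and circuits of depth `≥ 3`. A further landed support (not
used by the composition): `liouville_orthogonal_orLtf_combination` (`…OrLtfCombination.lean`) — any
Boolean function of `≤ n^α` ORs of `≤ n^A` tests (e.g. a majority vote among `n^α` polytopes).

RESHAPE v7 (lead `…-c4-0`, cycle 2). One more case is earned unconditionally, this time at every depth: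
`AC⁰` AUGMENTED WITH `O(log n)` MAJORITY GATES AT THE BOTTOM — every poly-size constant-depth `tcBasis`
circuit whose majority gates of fan-in `≥ 3` all sit at `acWeight`-depth `≤ 1` (so each is an integer
threshold test of the digits) and are at most `c₀ log n` in number (`c₀ = 1/(2⌈3/c⌉₊)`, `c` = Bourgain's
exponent) is orthogonal to `λ` (`stub_fewMaj` = `liouville_orthogonal_fewMaj`, LANDED p130757 in
`…FewMaj.lean`; gate-free form `stub_ac0FewLtf`, LANDED p130444): GUESS the `k` majority values (`stub_constSubst`, LANDED p129653; fan-in-`≥ 3` version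
`stub_constSubst3`, LANDED p130142 — `MAJ₀ = ∧₀`, `MAJ₁ = ∧₁`, `MAJ₂ = ∨₂` are `AC⁰` gates in the
extensional gate model), so that `C(x) = C'_{L(x)}(x)` with `2^k` circuits `C'_v` over `acBasis`; the
block sensitivity of `C` along any partition is at most that of the `k` tests (Peres, `stub_sensLtf`) plus
that of the `2^k` guesses (block ≤ total influence, `stub_blockInfluence`, LANDED p129696; Tal/Boppana
total influence of `AC⁰`, `stub_acInfluence`, LANDED p129754, ported from the tree's proof of Tal's
theorem `ACForm.tailWeight_le_tailBound`), hence the Fourier tail at the spectral level is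
`≪ (log n + (log n)^d)·n^{-1/(2R)} → 0` (`…FewMajSens(3).lean`, LANDED p129892 / …). Green's `AC⁰`
theorem is the case `k = 0`.

RESHAPE v8 (lead `…-c5-0`). The cleanest concrete piece of the v7 residue — ALL SYMMETRIC FUNCTIONS OF
THE DIGITS (Boolean functions of the Hamming weight `s₂(N)`; inside poly-size depth-two `MAJ ∘ MAJ` of top
fan-in `2n + 2`, with completely flat Walsh spectrum, e.g. `i^{s₂(N)}`, so that no spectral method and no
uniform Walsh bound alone can reach them) — is converted into ONE analytic hypothesis on the Gelfond sums
`S_n(α) = Σ_{N<2ⁿ} λ(N) e(α s₂(N))` at LARGE frequencies `n^{a−1/2} ≤ |α| ≤ 1/2` (`GelfondLiouvilleDecay`,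
Mauduit–Rivat type: in print for `Λ`, Ann. of Math. 171 (2010) Thm 1, and for `μ`, JEMS 17 (2015) Thm 2;
for `λ` by the same method, not printed — an explicit hypothesis, never a `sorry`). Everything else is
earned unconditionally: the SMALL frequencies `|α| ≤ n^{a−1/2}` from the tree's PROVED
`WalshLiouvilleBound` by the exact Krawtchouk–Walsh expansion of `e(α s₂)` and Green's splitting
(`stub_phaseTail`, `stub_gelfondSmall_of_tail`), and the SLICE CRITERION (`stub_sliceL2`, `stub_sliceTail`,
`stub_sliceCriterion_of`): a uniform bound `2ⁿ/n` at the `n + 1` frequencies `k/(n+1)` gives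
`Σ_j |Σ_{s₂(N)=j} λ(N)| ≤ ε 2ⁿ` (discrete Parseval on `ℤ/(n+1)`, Cauchy–Schwarz over the `O(√(n log(1/ε)))`
central slices, Hoeffding for the rest), i.e. `λ ⊥ G(s₂(N))` for every bounded `G`. The composition gains
the case "`C` computes a symmetric function of the digits (any depth, any size), under
`GelfondLiouvilleDecay`" (`symmetricRung_eventually` ← `stub_symmetricRung`) before the open residue.

RESHAPE v9 (lead `…-c6-0`). Three more pieces of the residue are earned, two of them from arithmetic
inputs the ladder had not used: (R1, UNCONDITIONAL) the TOP-DIGITS RUNG — `λ` is orthogonal to every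
Boolean function of the digits above position `ψ(n)`, for every non-decreasing `ψ(n) → ∞` (any circuit
ignoring the lowest `ψ(n)` digits, whatever its size and depth), from the tree's PROVED Matomäki–Radziwiłł
theorem (`matomaki_radziwill_holds`) via aligned dyadic blocks (`stub_windowAverage`, `stub_alignedBlocks`,
`stub_topDigits`, glue `topDigitsRung`); (R2, conditional on the PRINTED Müllner 2017 theorem = tree named
fact `mullner_moebius_automatic`) the FINITE-STATE-SCAN RUNG — for every fixed `S`, uniformly over all
`S`-state automata scanning the `n` input bits in either direction, e.g. parity, `s₂ mod m`, `N mod q`,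
Rudin–Shapiro (`stub_automaticFamily`, `stub_scanRung`, glue `scanRung_eventually`; the `λ`-form of
Müllner's theorem is the tree's `MobiusLadder.liouville_automatic_of_mullner`, no unprinted hypothesis);
(R3, UNCONDITIONAL) the NARROW-WAIST RUNG — any Boolean function of `≤ n^β` sub-circuits of the v7
few-majority class, e.g. a majority of `n^β` `AC⁰` circuits (`stub_waist`).

RESHAPE v10 (lead `…-c6-0`, cycle 2). The PTF RUNG (UNCONDITIONAL when its four stubs land): `λ` is
orthogonal to every polynomial threshold function of bounded degree in the digits (`[p(x) ≥ 0]`,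
`fourierDegree p ≤ d`), by the elementary Diakonikolas–Raghavendra–Servedio–Tan bound
`AS ≤ 2 m^{1−1/2^d}` (arXiv:0909.5011 §6) proved in counting form (`stub_drstRecursion`, `stub_drstAS`),
block reparametrisation (`stub_ptfBlock`) and the uniform spectral criterion (`stub_ptfRung`).

THE OPEN RESIDUE (where `stub_hyp_pos` is invoked, v7–v10): a majority gate of fan-in `> d log₂ n` ABOVE the
bottom level; or more than `c₀ log n` genuine majority gates at the bottom under an `AC⁰` top that also
reads raw digits; or (`acDepth = 2`) a majority gate over more than `n^α` distinct threshold gates — always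
with size polynomial of degree `≥ 1`. `MAJ ∘ MAJ` of polynomial top fan-in has no Fourier concentration,
so no further spectral reshaping is possible at depth two; beyond `O(log n)` bottom majority gates the
guessing costs `2^k` and one would need sensitivity TAIL bounds for `AC⁰` (not in the tree).

Stubs (registered, v9, ALL LANDED in wave 1 of lead c6): `stub_windowAverage` (T1a, p137878) · `stub_alignedBlocks` (T1b, p138501) ·
`stub_topDigits` (T2, p138891) · `stub_automaticFamily` (A1, p138883) · `stub_scanRung` (A3, p139014) · `stub_waist` (W1, p139149) ·
`stub_hyp_pos` (OPEN, crux-sized). Wave 2 (v9.1, ALL LANDED): `stub_ends_sqrt` (p139952) · `stub_topDigits_moebius` (p140051) ·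
`stub_scan_moebius` (p139966); packaged rungs `…TopDigits.lean` (p139597), `…FiniteStateScan.lean` (p139628).
Stubs (registered, v8.1, the Möbius bridge, all LANDED): `stub_decideLt` p134473 · `stub_lamOfMu`, `stub_muOfLam`,
`stub_sqTail` p134502 · `stub_sqTransfer` p135042 · headline `liouvilleOrthogonalTC0_iff_kalai` p135119
(`LiouvilleOrthogonalTC0 ↔ kalai_moebius_TC0`: the crux IS Kalai's catalogued TC⁰ conjecture for `μ`).
Stubs (registered, v8): `stub_phaseTail` (K1a) · `stub_gelfondSmall_of_tail` (K1b) · `stub_sliceL2` (K3a) ·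
`stub_sliceTail` (K3b) · `stub_sliceCriterion_of` (K3c) · `stub_symmetricRung` (lead) · `stub_hyp_pos` (OPEN,
crux-sized).
Stubs (registered, v7): `stub_constSubst` (LANDED p129653) · `stub_constSubst3` (LANDED p130142) ·
`stub_blockInfluence` (LANDED p129696) · `stub_acInfluence` (LANDED p129754) · `stub_fewMajTail(3)` (LANDED p129892 / …) ·
`stub_fewMaj` (LANDED p130757, `…FewMaj.lean`) · `stub_ac0FewLtf` (LANDED p130444, gate-free form).
Stubs (registered, v6): `stub_hyp_pos` (OPEN, crux-sized) · `stub_kaneClaim` (LANDED p127560) ·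
`stub_cubeTail` (LANDED p127309) · `stub_levelOne` (LANDED p127663) · `stub_depthTwo_nf` (LANDED p127876) ·
`stub_orLtf_translate` (LANDED p127574) · `stub_kaneSens` (LANDED p128206) · `stub_orLtf` (LANDED p128558) ·
`stub_depthTwoOrNf` (LANDED p128546).
Landed earlier: `stub_ltfInfluence` (W1; LANDED p124935) ·
`stub_peresTail` (W2; LANDED p125254) · `stub_depthOne_ltf` (W3; LANDED p124907) · `stub_ltfCore` (lead; LANDED p124832) ·
`stub_depthOne` (glue; LANDED p125536) · `stub_tailOfSens` + `stub_sensLtf` (lead; LANDED p125528) ·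
`stub_sizeK_sens` (W4; LANDED p126045) · `stub_sizeLe` (glue; LANDED p126208) · `stub_smallMajSim` (W5; LANDED p126099) ·
`stub_smallMaj` (glue; LANDED p126211) · `stub_spectral` (lead; LANDED p125112) · `stub_transfer_pos` (LANDED p123356).
-/

set_option linter.dupNamespace false -- D-0017: single-problem summit ⇒ `QuantumAdvantage.QuantumAdvantage` by design

noncomputable section

namespace Summit.QuantumAdvantage.LiouvilleOrthogonalTC0.Sketch

open Filter Finset
open Literature.Computability.Complexity
open Literature.Computability.Complexity.LowDegree (tailWeight)
open Literature.Probability.RandomGraphs.LowDegree (sgn)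
open Summit.QuantumAdvantage.QuantumAdvantage.Theses.MobiusLadder (LiouvilleOrthogonalTC0)
open Summit.QuantumAdvantage.QuantumAdvantage.Theorems.LiouvilleOrthogonalTC0

/-! ### The stubs -/

/-- **Stub (OPEN — the hypothesis, repaired in v3; honestly crux-sized).** Some constant-error
hardness of `Ω mod 2` on prime-window pieces holds at every scale exponent `A ≥ 1`. -/
theorem stub_hyp_pos :
    ∃ δ₀ κ Λ₀ : ℝ, 0 < δ₀ ∧ 0 < κ ∧ 1 ≤ Λ₀ ∧ ∀ A : ℕ, 1 ≤ A → LocalPieceHardness δ₀ κ Λ₀ A := by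
  sorry

/-- **Stub (the transfer from the repaired hypothesis; LANDED p123356).** -/
theorem stub_transfer_pos (δ₀ κ Λ₀ : ℝ) (hδ₀ : 0 < δ₀) (hκ : 0 < κ) (hΛ₀ : 1 ≤ Λ₀)
    (h : ∀ A : ℕ, 1 ≤ A → LocalPieceHardness δ₀ κ Λ₀ A) : LiouvilleOrthogonalTC0 :=
  Summit.QuantumAdvantage.QuantumAdvantage.Theorems.LiouvilleOrthogonalTC0.stub_transfer_pos
    δ₀ κ Λ₀ hδ₀ hκ hΛ₀ h

/-- **Stub (wave) — total influence of a linear threshold function** (the unate case of the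
level-1 inequality, O'Donnell, *Analysis of Boolean Functions*, §2.3/Ex. 2.5 & Prop. 3.2): for the
threshold function `g(σ) = [Θ ≤ Σ_l W_l σ_l]` on `{0,1}^m`, the number of pairs (point, sensitive
coordinate) is at most `2^m √m`, i.e. `I[g] = Σ_j |ĝ({j})| ≤ √m` by unateness, Cauchy–Schwarz and
Parseval (`LowDegree.sum_cubeFourierCoeff_sq`). -/
theorem stub_ltfInfluence (m : ℕ) (W : Fin m → ℝ) (Θ : ℝ) :
    (∑ σ : Fin m → Bool,
        ((univ.filter fun j : Fin m =>
            decide (Θ ≤ ∑ l, W l * (if σ l then (1 : ℝ) else 0)) ≠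
              decide (Θ ≤ ∑ l, W l * (if Function.update σ j (!σ j) l then (1 : ℝ) else 0))).card
          : ℝ))
      ≤ 2 ^ m * Real.sqrt m :=
  -- LANDED: `Theorems/MobiusLadderLiouvilleOrthogonalTC0StubLtfInfluence.lean` (p124935, worker W1)
  Summit.QuantumAdvantage.QuantumAdvantage.Theorems.LiouvilleOrthogonalTC0.stub_ltfInfluence m W Θ

/-- **Stub (wave) — Peres' theorem in Fourier-tail form, from the influence bound.** For a linear
threshold function `f(x) = [θ ≤ Σ_i w_i x_i]` of `n` Boolean variables and `m ≥ 1`, the Fourier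
weight of `sgn ∘ f` above level `m` is `≤ 3/√m`, uniformly in `n` and in the weights (Y. Peres,
*Noise stability of weighted majority*, 2004; O'Donnell §5.5): random `m`-partition `π` of the
variables, `g_x(σ) = f(x ⊕ π*σ)` is again a threshold function of `σ ∈ {0,1}^m`, so by the
hypothesis and the symmetry `x ↦ x ⊕ π*σ` the block noise sensitivity is `≤ 1/√m`; in the Walsh
basis this reads `Σ_S f̂(S)²(1 - (1-2/m)^{|S|}) ≤ 2/√m` (`Σ_π Π_{i∈S}(…)` by `Finset.prod_univ_sum`),
whence `(1 - e^{-2})·W^{≥m} ≤ 2/√m`. -/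
theorem stub_peresTail (n m : ℕ) (hm : 1 ≤ m) (w : Fin n → ℝ) (θ : ℝ)
    (hInf : ∀ (W : Fin m → ℝ) (Θ : ℝ),
      (∑ σ : Fin m → Bool,
          ((univ.filter fun j : Fin m =>
              decide (Θ ≤ ∑ l, W l * (if σ l then (1 : ℝ) else 0)) ≠
                decide (Θ ≤ ∑ l, W l * (if Function.update σ j (!σ j) l then (1 : ℝ) else 0))).card
            : ℝ))
        ≤ 2 ^ m * Real.sqrt m) :
    tailWeight (fun x : Fin n → Bool =>
        sgn (decide (θ ≤ ∑ i, w i * (if x i then (1 : ℝ) else 0)))) m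
      ≤ 3 / Real.sqrt m :=
  -- LANDED: `Theorems/MobiusLadderLiouvilleOrthogonalTC0StubPeresTail.lean` (p125254, worker W2)
  Summit.QuantumAdvantage.QuantumAdvantage.Theorems.LiouvilleOrthogonalTC0.stub_peresTail n m hm w θ hInf

/-- **Stub (wave) — depth-one threshold circuits are integer linear threshold functions.** A
circuit over `tcBasis` (`∧ₖ`, `∨ₖ`, `¬`, `MAJₖ`) with `acDepth ≤ 1` (negations free) computes
`x ↦ [θ ≤ Σ_i w_i x_i]` for some integer weights: wires of depth `0` are literals (inputs under
iterated `¬`); a weight-`1` gate of `tcBasis` is `[T ≤ 2·#ones]` of its literal arguments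
(`∧ₖ`: `T = 2k`, `∨ₖ`: `T = 2`, `MAJₖ`: `T = k`), an affine form in `x`; and the class is closed under
`¬` (`¬[θ ≤ L] = [1 - θ ≤ -L]` over `ℤ`). -/
theorem stub_depthOne_ltf {n : ℕ} (C : Circuit (Fin n)) (hB : C.IsOver tcBasis)
    (hd : C.acDepth ≤ 1) :
    ∃ (w : Fin n → ℤ) (θ : ℤ), ∀ x : Fin n → Bool,
      C.eval x = decide (θ ≤ ∑ i, w i * (if x i then (1 : ℤ) else 0)) :=
  -- LANDED: `Theorems/MobiusLadderLiouvilleOrthogonalTC0StubDepthOneLtf.lean` (p124907, worker W3)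
  Summit.QuantumAdvantage.QuantumAdvantage.Theorems.LiouvilleOrthogonalTC0.stub_depthOne_ltf C hB hd

/-- **Stub (lead) — `λ` is orthogonal to every linear threshold function of the binary digits,
given a uniform Fourier-tail bound for threshold functions.** Green's §2 deduction
(`GreenAC0.core_bound`) with BOTH the empty and the small characters bounded by Bourgain's uniform
Walsh bound `bourgain_liouville_walsh_holds` (`2^{n-n^{1/10}}`, levels `1 ≤ |S| ≤ k ≍ n^{1/32}`) and
the tail by the hypothesis at level `k + 1` (`W^{≥k+1} ≤ 3/√(k+1) → 0`). -/
theorem stub_ltfCore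
    (hTail : ∀ (n m : ℕ), 1 ≤ m → ∀ (w : Fin n → ℝ) (θ : ℝ),
      tailWeight (fun x : Fin n → Bool =>
          sgn (decide (θ ≤ ∑ i, w i * (if x i then (1 : ℝ) else 0)))) m ≤ 3 / Real.sqrt m) :
    ∀ ε : ℝ, 0 < ε → ∀ᶠ n : ℕ in atTop, ∀ (w : Fin n → ℤ) (θ : ℤ),
      |∑ N ∈ Finset.range (2 ^ n), ((ArithmeticFunction.liouville N : ℤ) : ℝ) *
          sgn (decide (θ ≤ ∑ i, w i * (if Nat.testBit N i then (1 : ℤ) else 0)))|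
        ≤ ε * (2 : ℝ) ^ n :=
  -- LANDED: `Theorems/MobiusLadderLiouvilleOrthogonalTC0StubLtfCore.lean` (p124832)
  Summit.QuantumAdvantage.QuantumAdvantage.Theorems.LiouvilleOrthogonalTC0.stub_ltfCore hTail

/-- **The depth-one rung (glue, proved from the stubs): `λ` is orthogonal to every `acDepth ≤ 1`
circuit over `tcBasis`, with no size restriction.** -/
theorem stub_depthOne : ∀ ε : ℝ, 0 < ε → ∀ᶠ n : ℕ in atTop, ∀ C : Circuit (Fin n),
    C.IsOver tcBasis → C.acDepth ≤ 1 →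
      |∑ N ∈ Finset.range (2 ^ n), ((ArithmeticFunction.liouville N : ℤ) : ℝ) *
          sgn (C.eval (fun i : Fin n => Nat.testBit N i))| ≤ ε * (2 : ℝ) ^ n := by
  -- glue of the four v4 stubs; LANDED verbatim as `Theorems/MobiusLadderLiouvilleOrthogonalTC0DepthOne.lean`
  -- (p125536: also `tailWeight_ltf_le` = Peres, `liouville_orthogonal_ltf`, `LiouvilleOrthogonalTC0_depth_le_one`)
  intro ε hε
  have hcore := stub_ltfCore
    (fun n m hm w θ => stub_peresTail n m hm w θ (stub_ltfInfluence m)) ε hε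
  filter_upwards [hcore] with n hn C hB hd
  obtain ⟨w, θ, hC⟩ := stub_depthOne_ltf C hB hd
  simpa only [hC] using hn w θ

/-- **Stub (lead, v5) — Peres' conclusion with a multiplicity constant.** Block sensitivity
`≤ B · 2ⁿ √m` for every `m`-partition ⇒ `W^{≥ m}[sgn ∘ f] ≤ 3B/√m` (`m ≥ 10`). -/
theorem stub_tailOfSens {n m : ℕ} (hm : 10 ≤ m) {B : ℝ} (f : (Fin n → Bool) → Bool)
    (hδ : ∀ π : Fin n → Fin m, ∑ x : Fin n → Bool,
      ((univ.filter fun j : Fin m => f x ≠ f (fun i => xor (x i) (decide (π i = j)))).card : ℝ)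
        ≤ B * (2 ^ n * Real.sqrt m)) :
    tailWeight (fun x => sgn (f x)) m ≤ 3 * B / Real.sqrt m :=
  -- LANDED: `Theorems/MobiusLadderLiouvilleOrthogonalTC0SensLtf.lean` (p125528, lead)
  Summit.QuantumAdvantage.QuantumAdvantage.Theorems.LiouvilleOrthogonalTC0.stub_tailOfSens hm f hδ

/-- **Stub (lead, v5) — block sensitivity of an integer threshold function** is `≤ 2ⁿ √m` for every
`m`-partition `π` (the heart of Peres' argument, from `stub_ltfInfluence`). -/
theorem stub_sensLtf {n m : ℕ} (w : Fin n → ℤ) (θ : ℤ) (π : Fin n → Fin m) :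
    ∑ x : Fin n → Bool, ((univ.filter fun j : Fin m =>
        decide (θ ≤ ∑ i, w i * (if x i then (1 : ℤ) else 0)) ≠
          decide (θ ≤ ∑ i, w i * (if xor (x i) (decide (π i = j)) then (1 : ℤ) else 0))).card : ℝ)
      ≤ 2 ^ n * Real.sqrt m :=
  -- LANDED: `Theorems/MobiusLadderLiouvilleOrthogonalTC0SensLtf.lean` (p125528, lead; used inside W4's stub)
  Summit.QuantumAdvantage.QuantumAdvantage.Theorems.LiouvilleOrthogonalTC0.stub_sensLtf w θ π

/-- **Stub (wave W4, v5) — block sensitivity of bounded-size threshold circuits.** A circuit over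
`tcBasis` with `≤ K` gates has block sensitivity `≤ 3^K · 2ⁿ √m` for every `m`-partition: gate `t` is
a threshold of an affine form in the inputs plus earlier gate values, i.e. one of `2^t` integer
threshold functions selected by the earlier values; union bound + `stub_sensLtf`, `Σ_{l<t} 3^l + 2^t ≤ 3^t`. -/
theorem stub_sizeK_sens {n m : ℕ} (K : ℕ) (C : Circuit (Fin n)) (hB : C.IsOver tcBasis)
    (hs : C.size ≤ K) (hm : 1 ≤ m) (π : Fin n → Fin m) :
    ∑ x : Fin n → Bool, ((univ.filter fun j : Fin m =>
        C.eval x ≠ C.eval (fun i => xor (x i) (decide (π i = j)))).card : ℝ)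
      ≤ 3 ^ K * (2 ^ n * Real.sqrt m) :=
  -- LANDED: `Theorems/MobiusLadderLiouvilleOrthogonalTC0StubSizeKSens.lean` (p126045, worker W4)
  Summit.QuantumAdvantage.QuantumAdvantage.Theorems.LiouvilleOrthogonalTC0.stub_sizeK_sens K C hB hs hm π

/-- **The spectral criterion (LANDED p125112).** -/
theorem stub_spectral (τ : ℕ → ℝ) (hτ : Tendsto τ atTop (nhds 0)) : ∀ ε : ℝ, 0 < ε → ∀ᶠ n : ℕ in atTop,
    ∀ F : (Fin n → Bool) → Bool,
      (∀ m : ℕ, 1 ≤ m → tailWeight (fun x : Fin n → Bool => sgn (F x)) m ≤ τ m) →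
        |∑ N ∈ Finset.range (2 ^ n), ((ArithmeticFunction.liouville N : ℤ) : ℝ) *
            sgn (F (fun i : Fin n => Nat.testBit N i))| ≤ ε * (2 : ℝ) ^ n :=
  Summit.QuantumAdvantage.QuantumAdvantage.Theorems.LiouvilleOrthogonalTC0.stub_spectral τ hτ

/-- **The bounded-size rung (glue, v5; registered stub `stub_sizeLe`): `λ` is orthogonal to every
circuit over `tcBasis` with at most `K` gates (any depth, any fan-in).** -/
theorem stub_sizeLe (K : ℕ) : ∀ ε : ℝ, 0 < ε → ∀ᶠ n : ℕ in atTop, ∀ C : Circuit (Fin n),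
    C.IsOver tcBasis → C.size ≤ K →
      |∑ N ∈ Finset.range (2 ^ n), ((ArithmeticFunction.liouville N : ℤ) : ℝ) *
          sgn (C.eval (fun i : Fin n => Nat.testBit N i))| ≤ ε * (2 : ℝ) ^ n := by
  -- glue of stub_sizeK_sens + stub_tailOfSens + stub_spectral; LANDED verbatim as
  -- `Theorems/MobiusLadderLiouvilleOrthogonalTC0SizeRung.lean` (p126208; also `LiouvilleOrthogonalTC0_size_const`)
  intro ε hε
  have hτ : Tendsto (fun m : ℕ => (3 : ℝ) ^ (K + 1) / Real.sqrt m) atTop (nhds 0) :=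
    tendsto_const_nhds.div_atTop (Real.tendsto_sqrt_atTop.comp tendsto_natCast_atTop_atTop)
  filter_upwards [stub_spectral (fun m : ℕ => (3 : ℝ) ^ (K + 1) / Real.sqrt m) hτ ε hε]
    with n hn C hB hs
  refine hn (fun y => C.eval y) (fun m hm => ?_)
  have hmpos : (0 : ℝ) < m := Nat.cast_pos.2 (by omega)
  have hs0 : 0 < Real.sqrt m := Real.sqrt_pos.2 hmpos
  by_cases hm9 : m ≤ 9
  · have h1 : tailWeight (fun x : Fin n → Bool => sgn (C.eval x)) m ≤ 1 :=
      Literature.Computability.Complexity.LowDegree.tailWeight_le_one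
        (fun x => by cases C.eval x <;> simp) m
    refine h1.trans ?_
    rw [le_div_iff₀ hs0, one_mul]
    calc Real.sqrt m ≤ Real.sqrt ((3 : ℝ) ^ 2) :=
          Real.sqrt_le_sqrt (by norm_num; exact_mod_cast hm9)
      _ = 3 := Real.sqrt_sq (by norm_num)
      _ ≤ (3 : ℝ) ^ (K + 1) := by
          calc (3 : ℝ) = 3 ^ 1 := (pow_one _).symm
            _ ≤ 3 ^ (K + 1) := pow_le_pow_right₀ (by norm_num) (by omega)
  · have hm10 : 10 ≤ m := by omega
    have h := stub_tailOfSens hm10 (B := (3 : ℝ) ^ K) (fun x => C.eval x)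
      (fun π => stub_sizeK_sens K C hB hs hm π)
    calc tailWeight (fun x : Fin n → Bool => sgn (C.eval x)) m ≤ 3 * (3 : ℝ) ^ K / Real.sqrt m := h
      _ = (3 : ℝ) ^ (K + 1) / Real.sqrt m := by rw [pow_succ]; ring

/-- **Stub (wave W5, v5) — majority gates of small fan-in are `AC⁰` gadgets (LANDED p126099).** A
circuit over `tcBasis` whose majority gates `MAJₖ` satisfy `2^k ≤ M` is simulated over `acBasis` at
`acDepth ≤ 2 · acDepth` and size `≤ size · (M + 1)` (`MAJₖ` = OR of the `C(k,⌈k/2⌉) ≤ 2^k` ANDs). -/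
theorem stub_smallMajSim {n : ℕ} (M : ℕ) (C : Circuit (Fin n)) (hB : C.IsOver tcBasis)
    (hM : ∀ g ∈ C.gates, ∀ k : ℕ, g.fn = GateFn.maj k → 2 ^ k ≤ M) :
    ∃ C' : Circuit (Fin n), C'.IsOver acBasis ∧ C'.acDepth ≤ 2 * C.acDepth ∧
      C'.size ≤ C.size * (M + 1) ∧ ∀ x, C'.eval x = C.eval x :=
  -- LANDED: `Theorems/MobiusLadderLiouvilleOrthogonalTC0StubSmallMajSim.lean` (p126099, worker W5)
  Summit.QuantumAdvantage.QuantumAdvantage.Theorems.LiouvilleOrthogonalTC0.stub_smallMajSim M C hB hM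

/-- **The small-fan-in rung (glue, v5; registered stub `stub_smallMaj`): `λ` is orthogonal to every
constant-depth polynomial-size circuit over `tcBasis` all of whose majority gates have fan-in
`k` with `2^k ≤ n^{c₀}`** — by `stub_smallMajSim` and the tree's `AC⁰` rung at depth `2d`, size
`p · (X^{c₀} + 1)`. -/
theorem stub_smallMaj (c₀ d : ℕ) (p : Polynomial ℕ) : ∀ ε : ℝ, 0 < ε →
    ∀ᶠ n : ℕ in atTop, ∀ C : Circuit (Fin n), C.IsOver tcBasis →
      (∀ g ∈ C.gates, ∀ k : ℕ, g.fn = GateFn.maj k → 2 ^ k ≤ n ^ c₀) →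
        C.acDepth ≤ d → C.size ≤ p.eval n →
          |∑ N ∈ Finset.range (2 ^ n), ((ArithmeticFunction.liouville N : ℤ) : ℝ) *
              sgn (C.eval (fun i : Fin n => Nat.testBit N i))| ≤ ε * (2 : ℝ) ^ n := by
  -- glue of stub_smallMajSim + the tree's AC⁰ rung; LANDED verbatim as
  -- `Theorems/MobiusLadderLiouvilleOrthogonalTC0SmallMaj.lean` (p126211)
  intro ε hε
  have hAC := Summit.QuantumAdvantage.QuantumAdvantage.Theorems.LiouvilleOrthogonalAC0_proof
  unfold Summit.QuantumAdvantage.QuantumAdvantage.Theses.MobiusLadder.LiouvilleOrthogonalAC0 at hAC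
  filter_upwards [hAC (2 * d) (p * (Polynomial.X ^ c₀ + 1)) ε hε] with n hn C hB hM hd hs
  obtain ⟨C', hB', hd', hs', heval⟩ := stub_smallMajSim (n ^ c₀) C hB hM
  have hsize : C'.size ≤ (p * (Polynomial.X ^ c₀ + 1)).eval n := by
    rw [Polynomial.eval_mul, Polynomial.eval_add, Polynomial.eval_pow, Polynomial.eval_X,
      Polynomial.eval_one]
    exact hs'.trans (Nat.mul_le_mul_right _ hs)
  have hdepth : C'.acDepth ≤ 2 * d := hd'.trans (Nat.mul_le_mul_left 2 hd)
  have h := hn C' hB' hdepth hsize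
  simp only [heval] at h
  exact h

/-! ### The v6 stubs: Kane's theorem and the depth-two `∧/∨`-top rung -/

/-- **Stub (wave W-A, v6) — Kane's one-step inequality** (Kane 2014, proof of Prop. 3, the Claim
and the three displayed lines after it, in counting form on `{0,1}^m`). Let `F, f : {0,1}^m → {0,1}`
with `f` UNATE of orientation `o` (moving coordinate `j` from `¬o_j` to `o_j` can only switch `f`
on), `G = F ∨ f`, `S = G ∧ ¬F = ¬F ∧ f`, and `x_j(σ) = +1` if `σ_j = o_j`, `-1` otherwise. Then
`#{(σ,j) : G(σ) ≠ G(σ^{⊕j})} - #{(σ,j) : F(σ) ≠ F(σ^{⊕j})} ≤ 2 Σ_σ S(σ) Σ_j x_j(σ)`: pointwise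
`|G σ - G σ^j| - |F σ - F σ^j| ≤ x_j(σ)((G σ - G σ^j) - (F σ - F σ^j))` (if `f σ = f σ^j = 0` both
sides vanish; otherwise w.l.o.g. `σ_j = o_j`, then `f σ = 1 = G σ`), and
`Σ_{σ,j} x_j(σ)(S σ - S σ^j) = 2 Σ_σ S σ Σ_j x_j(σ)` by the substitution `σ ↦ σ^{⊕j}`. -/
theorem stub_kaneClaim {m : ℕ} (F f : (Fin m → Bool) → Bool) (o : Fin m → Bool)
    (hf : ∀ (σ : Fin m → Bool) (j : Fin m),
      f (Function.update σ j (!o j)) = true → f (Function.update σ j (o j)) = true) :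
    (∑ σ : Fin m → Bool, ((univ.filter fun j : Fin m =>
        (F σ || f σ) ≠ (F (Function.update σ j (!σ j)) || f (Function.update σ j (!σ j)))).card : ℝ))
      - (∑ σ : Fin m → Bool, ((univ.filter fun j : Fin m =>
          F σ ≠ F (Function.update σ j (!σ j))).card : ℝ))
      ≤ 2 * ∑ σ : Fin m → Bool, (if (!F σ && f σ) = true then
          ∑ j : Fin m, (if σ j = o j then (1 : ℝ) else -1) else 0) :=
  -- LANDED: `Theorems/MobiusLadderLiouvilleOrthogonalTC0StubKaneClaim.lean` (p127560, c4 worker W-A)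
  Summit.QuantumAdvantage.QuantumAdvantage.Theorems.LiouvilleOrthogonalTC0.stub_kaneClaim F f o hf

/-- **Stub (wave W-B, v6) — the Hoeffding count on the cube.** For every orientation `o` and
`t ≥ 0`, `#{σ ∈ {0,1}^m : t ≤ Σ_j x_j(σ)} ≤ 2^m e^{-t²/(2m)}` where `x_j(σ) = ±1` according as
`σ_j = o_j` or not (exponential moment: `Σ_σ e^{λ Σ_j x_j(σ)} = (2 cosh λ)^m ≤ 2^m e^{mλ²/2}`,
`Finset.prod_univ_sum` and `Real.cosh_le_exp_half_sq`, then Markov with `λ = t/m`). -/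
theorem stub_cubeTail (m : ℕ) (o : Fin m → Bool) (t : ℝ) (ht : 0 ≤ t) :
    (((univ : Finset (Fin m → Bool)).filter fun σ =>
        t ≤ ∑ j : Fin m, (if σ j = o j then (1 : ℝ) else -1)).card : ℝ)
      ≤ 2 ^ m * Real.exp (-(t ^ 2 / (2 * m))) :=
  -- LANDED: `Theorems/MobiusLadderLiouvilleOrthogonalTC0StubCubeTail.lean` (p127309, lead c4)
  Summit.QuantumAdvantage.QuantumAdvantage.Theorems.LiouvilleOrthogonalTC0.stub_cubeTail m o t ht

/-- **Stub (wave W-C, v6) — Kane's Lemma 6 (the level-one inequality) from the tail bound.**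
For a nonempty `S ⊆ {0,1}^m` of size `s` and any orientation, `Σ_{σ∈S} Σ_j x_j(σ) ≤
s (√(2m log(2^m (m+1)/s)) + 2)`: with `T = Σ_j x_j ≤ m` and any `y ≥ 0`,
`Σ_{σ∈S} T ≤ s y + Σ_σ (T-y)₊ ≤ s y + Σ_{u=0}^{m} #{σ : y + u ≤ T} ≤ s y + (m+1) 2^m e^{-y²/(2m)}`,
and `y = √(2m log(2^m(m+1)/s))` makes the last term `= s`. -/
theorem stub_levelOne (m : ℕ) (hm : 1 ≤ m)
    (hTail : ∀ (o : Fin m → Bool) (t : ℝ), 0 ≤ t →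
      (((univ : Finset (Fin m → Bool)).filter fun σ =>
          t ≤ ∑ j : Fin m, (if σ j = o j then (1 : ℝ) else -1)).card : ℝ)
        ≤ 2 ^ m * Real.exp (-(t ^ 2 / (2 * m))))
    (o : Fin m → Bool) (S : Finset (Fin m → Bool)) (hS : S.Nonempty) :
    ∑ σ ∈ S, ∑ j : Fin m, (if σ j = o j then (1 : ℝ) else -1)
      ≤ S.card * (Real.sqrt (2 * m * Real.log (2 ^ m * (m + 1) / S.card)) + 2) :=
  -- LANDED: `Theorems/MobiusLadderLiouvilleOrthogonalTC0StubLevelOne.lean` (p127663, c4 worker W-C)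
  Summit.QuantumAdvantage.QuantumAdvantage.Theorems.LiouvilleOrthogonalTC0.stub_levelOne m hm hTail o S hS

/-- **Stub (wave W-D, v6) — the depth-two normal form.** A circuit over `tcBasis` with
`acDepth ≤ 2` computes, up to a free negation `b`, either an `OR` of `K ≤ size + n` integer linear
threshold tests of the inputs (top gate `∨`; top gate `∧` by De Morgan, the negation of an integer
test being one; or the whole circuit of depth `≤ 1`), or a MAJORITY with multiplicities of `K ≤ size + n`
such tests (top gate `MAJₖ`: `[k ≤ 2·#ones]`, the distinct argument wires — inputs or earlier gates,
each of `acDepth ≤ 1`, hence an integer test by `DepthOneLtf.wire_invariant` — counted with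
multiplicity). -/
theorem stub_depthTwo_nf {n : ℕ} (C : Circuit (Fin n)) (hB : C.IsOver tcBasis) (hd : C.acDepth ≤ 2) :
    ∃ (K : ℕ) (b : Bool) (w : Fin K → Fin n → ℤ) (t : Fin K → ℤ), K ≤ C.size + n ∧
      ((∀ x : Fin n → Bool, C.eval x = xor b (decide (∃ a : Fin K,
          t a ≤ ∑ i, w a i * (if x i then (1 : ℤ) else 0)))) ∨
       (∃ (μ : Fin K → ℕ) (θ : ℕ), ∀ x : Fin n → Bool, C.eval x = xor b (decide (θ ≤ 2 * ∑ a : Fin K,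
          μ a * (decide (t a ≤ ∑ i, w a i * (if x i then (1 : ℤ) else 0))).toNat)))) :=
  -- LANDED: `Theorems/MobiusLadderLiouvilleOrthogonalTC0StubDepthTwoNf.lean` (p127876, c4 worker W-D)
  Summit.QuantumAdvantage.QuantumAdvantage.Theorems.LiouvilleOrthogonalTC0.stub_depthTwo_nf C hB hd

/-- **Stub (wave W-E, v6) — block translates of an `OR` of threshold tests are `OR`s of unate
functions.** For integer tests `L_a(x) = [t_a ≤ Σ_i w_{a,i} x_i]`, a partition `π : [n] → [m]` and a
base point `x`, each translate `σ ↦ L_a(x ⊕ π^*σ)` is a real threshold function of `σ ∈ {0,1}^m`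
(`StubPeresTail.ltf_translate`), hence unate with orientation `o_{a,l} = [0 ≤ W_{a,l}]`. -/
theorem stub_orLtf_translate {n m K : ℕ} (w : Fin K → Fin n → ℤ) (t : Fin K → ℤ)
    (π : Fin n → Fin m) (x : Fin n → Bool) :
    ∃ (f : Fin K → (Fin m → Bool) → Bool) (o : Fin K → Fin m → Bool),
      (∀ (a : Fin K) (σ : Fin m → Bool) (j : Fin m),
        f a (Function.update σ j (!o a j)) = true → f a (Function.update σ j (o a j)) = true) ∧
      ∀ σ : Fin m → Bool,
        decide (∃ a : Fin K, t a ≤ ∑ i, w a i * (if xor (x i) (σ (π i)) then (1 : ℤ) else 0)) =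
          decide (∃ a : Fin K, f a σ = true) :=
  -- LANDED: `Theorems/MobiusLadderLiouvilleOrthogonalTC0StubOrLtfTranslate.lean` (p127574, c4 worker W-E)
  Summit.QuantumAdvantage.QuantumAdvantage.Theorems.LiouvilleOrthogonalTC0.stub_orLtf_translate w t π x

/-- **Stub (lead, v6) — Kane's Proposition 3 in counting form.** For unate
`f_1, …, f_K : {0,1}^m → {0,1}` (orientations `o_a`) and `F = ⋁_a f_a`,
`#{(σ, j) : F(σ) ≠ F(σ^{⊕j})} ≤ (4√(log((K+1)(m+1))) + 8) · 2^m √m` (`m ≥ 1`): telescoping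
`F_r = ⋁_{a<r} f_a` with `stub_kaneClaim`, the sets `S_r = f_r ∧ ¬F_r` being disjoint; `stub_levelOne`
for `|S_r| ≥ 2^m/((K+1)²(m+1))` and the trivial bound `Σ_{S_r} T ≤ m |S_r|` below. -/
theorem stub_kaneSens {m K : ℕ} (hm : 1 ≤ m) (f : Fin K → (Fin m → Bool) → Bool)
    (o : Fin K → Fin m → Bool)
    (hf : ∀ (a : Fin K) (σ : Fin m → Bool) (j : Fin m),
      f a (Function.update σ j (!o a j)) = true → f a (Function.update σ j (o a j)) = true) :
    (∑ σ : Fin m → Bool, ((univ.filter fun j : Fin m =>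
        decide (∃ a : Fin K, f a σ = true) ≠
          decide (∃ a : Fin K, f a (Function.update σ j (!σ j)) = true)).card : ℝ))
      ≤ (4 * Real.sqrt (Real.log ((K + 1) * (m + 1))) + 8) * (2 ^ m * Real.sqrt m) :=
  -- LANDED: `Theorems/MobiusLadderLiouvilleOrthogonalTC0StubKaneSens.lean` (p128206, c4 worker)
  Summit.QuantumAdvantage.QuantumAdvantage.Theorems.LiouvilleOrthogonalTC0.stub_kaneSens hm f o hf

/-- **The depth-two `∧/∨`-top rung (glue, v6; lead): `λ` is orthogonal to every `AND/OR` of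
polynomially many linear threshold tests of the binary digits**, unconditionally: for every `A`, every
`ε > 0`, eventually in `n`, for all `K ≤ n^A`, `b`, integer `w, t`,
`|Σ_{N<2ⁿ} λ(N) sgn (b ⊕ [∃ a < K, t_a ≤ Σ_i w_{a,i} bit_i(N)])| ≤ ε 2ⁿ`. -/
theorem stub_orLtf (A : ℕ) : ∀ ε : ℝ, 0 < ε → ∀ᶠ n : ℕ in atTop, ∀ K : ℕ, K ≤ n ^ A →
    ∀ (b : Bool) (w : Fin K → Fin n → ℤ) (t : Fin K → ℤ),
      |∑ N ∈ Finset.range (2 ^ n), ((ArithmeticFunction.liouville N : ℤ) : ℝ) *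
          sgn (xor b (decide (∃ a : Fin K,
            t a ≤ ∑ i, w a i * (if Nat.testBit N i then (1 : ℤ) else 0))))| ≤ ε * (2 : ℝ) ^ n :=
  -- LANDED: `Theorems/MobiusLadderLiouvilleOrthogonalTC0OrLtf.lean` (p128558, lead c4; also `liouville_orthogonal_andLtf`)
  Summit.QuantumAdvantage.QuantumAdvantage.Theorems.LiouvilleOrthogonalTC0.stub_orLtf A

/-- **Stub (lead c4, v6) — the depth-two normal form, OR-form under the syntactic side condition
"every majority gate sits at `acWeight`-depth `≤ 1`"** (the top non-negation gate, if at depth two,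
is `∧ₖ`/`∨ₖ`): the circuit computes `b ⊕ [∃ a < K, t_a ≤ Σ_i w_{a,i} x_i]` with `K ≤ size + n`.
This is the hypothesis under which the Kane rung applies in circuit language. -/
theorem stub_depthTwoOrNf {n : ℕ} (C : Circuit (Fin n)) (hB : C.IsOver tcBasis) (hd : C.acDepth ≤ 2)
    (hM : ∀ (j : ℕ) (hj : j < C.gates.length), (∃ k, (C.gates[j]).fn = GateFn.maj k) →
      (GateList.wdepths acWeight C.gates).getD j 0 ≤ 1) :
    ∃ (K : ℕ) (b : Bool) (w : Fin K → Fin n → ℤ) (t : Fin K → ℤ), K ≤ C.size + n ∧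
      ∀ x : Fin n → Bool, C.eval x = xor b (decide (∃ a : Fin K,
          t a ≤ ∑ i, w a i * (if x i then (1 : ℤ) else 0))) :=
  -- LANDED: `Theorems/MobiusLadderLiouvilleOrthogonalTC0DepthTwoOrNf.lean` (p128546, lead c4)
  Summit.QuantumAdvantage.QuantumAdvantage.Theorems.LiouvilleOrthogonalTC0.stub_depthTwoOrNf C hB hd hM

/-! ### The v7 stubs: `AC⁰` with `O(log n)` majority gates at the bottom (lead c4) -/

/-- **Stub (wave W-F, v7) — constants for the majority gates.** Replacing every majority gate of a
`tcBasis` circuit by the constant gate `∧₀` (true) / `∨₀` (false) prescribed by `v` gives a circuit over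
`acBasis` of no larger `acDepth` and size which agrees with `C` at every input `x` at which `v` guesses
the values of the majority gates correctly (gate-list surgery: the replaced gate keeps its position, so
all wires stay valid; values by induction on the program). -/
theorem stub_constSubst {n : ℕ} (C : Circuit (Fin n)) (hB : C.IsOver tcBasis) (v : ℕ → Bool) :
    ∃ C' : Circuit (Fin n), C'.IsOver acBasis ∧ C'.acDepth ≤ C.acDepth ∧ C'.size ≤ C.size ∧
      ∀ x : Fin n → Bool,
        (∀ (j : ℕ) (hj : j < C.gates.length), (∃ k, (C.gates[j]).fn = GateFn.maj k) →
          v j = (GateList.vals C.gates x).getD j false) →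
        C'.eval x = C.eval x :=
  -- LANDED: `Theorems/MobiusLadderLiouvilleOrthogonalTC0StubConstSubst.lean` (p129653, c4 worker W-F)
  Summit.QuantumAdvantage.QuantumAdvantage.Theorems.LiouvilleOrthogonalTC0.stub_constSubst C hB v

/-- **Stub (lead, v7) — constants for the GENUINE majority gates** (fan-in `≥ 3`; `MAJ₀ = ∧₀`,
`MAJ₁ = ∧₁`, `MAJ₂ = ∨₂` coincide with `AC⁰` gates and stay): the resulting circuit is over `acBasis`. -/
theorem stub_constSubst3 {n : ℕ} (C : Circuit (Fin n)) (hB : C.IsOver tcBasis) (v : ℕ → Bool) :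
    ∃ C' : Circuit (Fin n), C'.IsOver acBasis ∧ C'.acDepth ≤ C.acDepth ∧ C'.size ≤ C.size ∧
      ∀ x : Fin n → Bool,
        (∀ (j : ℕ) (hj : j < C.gates.length), (∃ k, 3 ≤ k ∧ (C.gates[j]).fn = GateFn.maj k) →
          v j = (GateList.vals C.gates x).getD j false) →
        C'.eval x = C.eval x :=
  -- LANDED: `Theorems/MobiusLadderLiouvilleOrthogonalTC0StubConstSubst3.lean` (p130142, lead c4)
  Summit.QuantumAdvantage.QuantumAdvantage.Theorems.LiouvilleOrthogonalTC0.stub_constSubst3 C hB v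

/-- **Stub (wave W-G, v7) — block influence is at most total influence.** For every Boolean function
`G` of `n` bits and every partition `π : [n] → [m]`, the number of pairs (point, sensitive BLOCK) is at
most the number of pairs (point, sensitive COORDINATE): flip the block one coordinate at a time; each
step is a bijection of the cube. -/
theorem stub_blockInfluence {n m : ℕ} (G : (Fin n → Bool) → Bool) (π : Fin n → Fin m) :
    ∑ x : Fin n → Bool, ((univ.filter fun j : Fin m =>
        G x ≠ G (fun i => xor (x i) (decide (π i = j)))).card : ℝ)
      ≤ ∑ i : Fin n, ((univ.filter fun x : Fin n → Bool =>
          G x ≠ G (Function.update x i (!x i))).card : ℝ) :=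
  -- LANDED: `Theorems/MobiusLadderLiouvilleOrthogonalTC0StubBlockInfluence.lean` (p129696, c4 worker W-G)
  Summit.QuantumAdvantage.QuantumAdvantage.Theorems.LiouvilleOrthogonalTC0.stub_blockInfluence G π

/-- **Stub (wave W-H, v7) — total influence of a shallow circuit** (Boppana / Linial–Mansour–Nisan
via Tal's exponentially small Fourier tails, tree `ACForm.tailWeight_le_tailBound`): for a circuit over
`acBasis` on `n` bits of `acDepth ≤ d` and `≤ s` gates (`s ≥ 1`), the number of pairs (point, sensitive
coordinate) is `≤ 2ⁿ · A^{d+2} B^{d+2} ℓ^d / log 2`, `ℓ = logM (2s)`, `A = ACForm.cA`, `B = ACForm.cB`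
(pattern: `Summits/PneNP/PneNP/Theorems/OneSliceShallowSliceBoundInfluence.lean`). -/
theorem stub_acInfluence {n : ℕ} (G : Circuit (Fin n)) (hG : G.IsOver acBasis) {d s : ℕ}
    (hd : G.acDepth ≤ d) (hs : G.size ≤ s) (h1 : 1 ≤ s) :
    ∑ i : Fin n, ((univ.filter fun x : Fin n → Bool =>
        G.eval x ≠ G.eval (Function.update x i (!x i))).card : ℝ)
      ≤ 2 ^ n * ((ACForm.cA : ℝ) ^ (d + 2) * (ACForm.cB : ℝ) ^ (d + 2) *
          (ACForm.logM (2 * s) : ℝ) ^ d / Real.log 2) :=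
  -- LANDED: `Theorems/MobiusLadderLiouvilleOrthogonalTC0StubAcInfluence.lean` (p129754, c4 worker W-H)
  Summit.QuantumAdvantage.QuantumAdvantage.Theorems.LiouvilleOrthogonalTC0.stub_acInfluence G hG hd hs h1

/-- **Stub (lead, v7) — the few-majority rung: `λ` is orthogonal to every polynomial-size
constant-depth circuit over `tcBasis` with at most `c₀ log n` majority gates of fan-in `≥ 3`, all at the
bottom** (each reading only literals, of ANY fan-in; the rest of the circuit is `AC⁰` reading the digits
and these gates; `MAJ₀ = ∧₀`, `MAJ₁ = ∧₁`, `MAJ₂ = ∨₂` are `AC⁰` gates in the extensional gate model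
and are not constrained — `stub_constSubst3`). Guess the `k ≤ c₀ log n` majority values (`stub_constSubst`): the block sensitivity of `C` is at
most that of the `k` threshold gates (`stub_sensLtf`, `k·2ⁿ√m`) plus that of the `2^k` guessed `AC⁰`
circuits (`stub_blockInfluence` + `stub_acInfluence`, `2^k · 2ⁿ · polylog`), so the Fourier tail at the
spectral level `⌊n^{1/R}⌋₊ + 1` is `≪ (log n) n^{-1/(2R)} + n^{c₀ - 1/R} polylog → 0` for `c₀ < 1/R`
(`stub_tailOfSens`, `liouville_orthogonal_of_tailWeight_level`). Green's `AC⁰` theorem is `k = 0`. -/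
theorem stub_fewMaj : ∃ c₀ : ℝ, 0 < c₀ ∧ ∀ (d : ℕ) (p : Polynomial ℕ) (ε : ℝ), 0 < ε →
    ∀ᶠ n : ℕ in atTop, ∀ C : Circuit (Fin n), C.IsOver tcBasis → C.acDepth ≤ d → C.size ≤ p.eval n →
      (∀ (j : ℕ) (hj : j < C.gates.length), (∃ k, 3 ≤ k ∧ (C.gates[j]).fn = GateFn.maj k) →
        (GateList.wdepths acWeight C.gates).getD j 0 ≤ 1) →
      (((Finset.univ.filter fun j : Fin C.gates.length =>
          3 ≤ (C.gates[j]).arity ∧ (C.gates[j]).fn = GateFn.maj (C.gates[j]).arity).card : ℝ) ≤ c₀ * Real.log n) →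
        |∑ N ∈ Finset.range (2 ^ n), ((ArithmeticFunction.liouville N : ℤ) : ℝ) *
            sgn (C.eval (fun i : Fin n => Nat.testBit N i))| ≤ ε * (2 : ℝ) ^ n :=
  -- LANDED: `Theorems/MobiusLadderLiouvilleOrthogonalTC0FewMaj.lean` (lead c4; accounting `…FewMajSens3.lean` p130269)
  Summit.QuantumAdvantage.QuantumAdvantage.Theorems.LiouvilleOrthogonalTC0.stub_fewMaj

/-- **The few-majority rung, gate-free form (lead c4, v7; LANDED `…FewLtfAC0.lean`, p130444):** `λ` is
orthogonal to every polynomial-size constant-depth circuit over `acBasis` on `n + k` inputs fed with the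
`n` digits and the values of `k ≤ c₀ log n` arbitrary integer linear threshold tests of the digits. Not used
by the composition (which is phrased on `tcBasis` circuits); recorded as the quotable form of v7. -/
theorem stub_ac0FewLtf : ∃ c₀ : ℝ, 0 < c₀ ∧ ∀ (d : ℕ) (p : Polynomial ℕ) (ε : ℝ), 0 < ε →
    ∀ᶠ n : ℕ in atTop, ∀ k : ℕ, (k : ℝ) ≤ c₀ * Real.log n →
      ∀ C : Circuit (Fin n ⊕ Fin k), C.IsOver acBasis → C.acDepth ≤ d → C.size ≤ p.eval n →
        ∀ (w : Fin k → Fin n → ℤ) (θ : Fin k → ℤ),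
          |∑ N ∈ Finset.range (2 ^ n), ((ArithmeticFunction.liouville N : ℤ) : ℝ) *
              sgn (C.eval (Sum.elim (fun i : Fin n => Nat.testBit N i)
                (fun a => decide (θ a ≤ ∑ i, w a i * (if Nat.testBit N i then (1 : ℤ) else 0)))))|
            ≤ ε * (2 : ℝ) ^ n :=
  Summit.QuantumAdvantage.QuantumAdvantage.Theorems.LiouvilleOrthogonalTC0.stub_ac0FewLtf

/-- Polynomial size plus `n` is eventually below a power of `n`. -/
theorem eventually_eval_add_le_pow (p : Polynomial ℕ) :
    ∀ᶠ n : ℕ in atTop, p.eval n + n ≤ n ^ (p.natDegree + 2) := by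
  filter_upwards [eventually_ge_atTop (p.eval 1 + 2)] with n hn
  have hn1 : 1 ≤ n := by omega
  have h1 : p.eval n ≤ p.eval 1 * n ^ p.natDegree := by
    rw [Polynomial.eval_eq_sum_range, Polynomial.eval_eq_sum_range, Finset.sum_mul]
    refine Finset.sum_le_sum fun i hi => ?_
    rw [one_pow, mul_one]
    have hi' : i ≤ p.natDegree := by
      have := Finset.mem_range.1 hi; omega
    exact Nat.mul_le_mul_left _ (Nat.pow_le_pow_right hn1 hi')
  calc p.eval n + n ≤ p.eval 1 * n ^ p.natDegree + n * n ^ p.natDegree := by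
        have : n ≤ n * n ^ p.natDegree := Nat.le_mul_of_pos_right _ (Nat.pow_pos hn1)
        omega
    _ = (p.eval 1 + n) * n ^ p.natDegree := by ring
    _ ≤ (n * n) * n ^ p.natDegree := by
        refine Nat.mul_le_mul_right _ ?_
        nlinarith
    _ = n ^ (p.natDegree + 2) := by ring


/-! ### Skeleton v8 (lead c5): the symmetric-digital rung

Functions of the HAMMING WEIGHT `s₂(N) = #{i < n : bit_i(N) = 1}` of the digits ("symmetric functions of
the digits") are computed by depth-two `MAJ ∘ MAJ` circuits of top fan-in `2n + 2` and polynomial size,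
and contain functions with completely flat Walsh spectrum (`i^{s₂(N)}`), so NO spectral reshaping reaches
them: they sit in the v7 residue. v8 converts this sub-residue into ONE purely analytic hypothesis on the
Gelfond sums `S_n(α) = Σ_{N<2ⁿ} λ(N) e(α s₂(N))`:

* K1 (`stub_phaseTail` + `stub_gelfondSmall_of_tail`, UNCONDITIONAL): `|S_n(α)| ≤ 2ⁿ n^{-B}` for
  `|α| ≤ n^{a-1/2}` (some `a > 0`, every `B`), from the tree's PROVED `WalshLiouvilleBound`: the exact
  Walsh expansion `e(α s₂) = Σ_S ((1+e(α))/2)^{n-|S|} ((1-e(α))/2)^{|S|} w_S` has squared coefficients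
  `cos²(πα)^{n-|S|} sin²(πα)^{|S|}`, whose mass above level `m` is `≤ e^{-m}(1+(e-1)sin²πα)ⁿ ≤ e^{2n sin²πα - m}`
  (exponential tilt); Green's §2 splitting (`GreenAC0.core_bound`) at level `m ≍ n^{1/R}` then gives
  `|S_n(α)| ≤ 2·2^{n-n^c}(n+1)^m + 2·2ⁿ e^{n sin²(πα) - m/2}`;
* K3 (`stub_sliceL2` + `stub_sliceTail` + `stub_sliceCriterion_of`, UNCONDITIONAL): a UNIFORM bound
  `|S_n(k/(n+1))| ≤ 2ⁿ/n` at the `n + 1` frequencies `k/(n+1)` gives `Σ_j |Σ_{s₂(N)=j} λ(N)| ≤ ε 2ⁿ`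
  (discrete Parseval on `ℤ/(n+1)`: `Σ_j A_j² = (n+1)⁻¹ Σ_k |S_n(k/(n+1))|²`; Cauchy–Schwarz over the
  `< 2√(n log(8/ε)) + 1` central slices; the Hoeffding count for the far slices), hence
  `λ ⊥ G(s₂(N))` for every bounded `G`;
* the hypothesis `GelfondLiouvilleDecay` (large frequencies, `n^{a-1/2} ≤ |α| ≤ 1/2`:
  `|S_n(α)| ≤ 2ⁿ n^{-B}`): Mauduit–Rivat strength `x^{-c‖α‖²}` is IN PRINT for `Λ` (Mauduit–Rivat,
  Ann. of Math. 171 (2010), Thm 1) and for `μ` (Mauduit–Rivat, JEMS 17 (2015), Thm 2, with MR2010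
  Lemmas 9 and 16 for the carry and Fourier properties of `e(α s₂)`); for `λ` it follows by the same
  type-I/II method (the tree already has the generic identity
  `LiouvilleWalshVaughan.sum_liouville_mul_eq_vaughan`) but is not printed, so it is an explicit
  HYPOTHESIS of `stub_symmetricRung` and of the v8 composition case — never a `sorry`.
-/

/-- **Stub K1a (wave, v8) — Fourier tail of the Gelfond phase on the cube.** For every `n`, `m`,
`α`: the real and imaginary parts of `y ↦ e(α·#{i : y_i = 1})` on `{0,1}ⁿ` have Fourier weight
above level `m` at most `exp(2n sin²(πα) − m)`. (Exact coefficients: `2^{-n} Σ_y e(α|y|) w_S(y) =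
Π_{i∉S} (1+e(α))/2 · Π_{i∈S} (1−e(α))/2`, of squared modulus `cos²(πα)^{n−|S|} sin²(πα)^{|S|}`; the
real/imaginary parts have coefficients the real/imaginary parts of these; tilt:
`Σ_{|S|≥m} c^{n−|S|} s^{|S|} ≤ e^{−m} Σ_S c^{n−|S|}(es)^{|S|} = e^{−m}(1+(e−1)s)ⁿ ≤ e^{(e−1)ns−m}`.) -/
theorem stub_phaseTail (n m : ℕ) (α : ℝ) :
    tailWeight (fun y : Fin n → Bool =>
        Real.cos (2 * Real.pi * α * ((Finset.univ.filter fun i : Fin n => y i = true).card : ℝ))) m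
        ≤ Real.exp (2 * n * Real.sin (Real.pi * α) ^ 2 - m) ∧
      tailWeight (fun y : Fin n → Bool =>
        Real.sin (2 * Real.pi * α * ((Finset.univ.filter fun i : Fin n => y i = true).card : ℝ))) m
        ≤ Real.exp (2 * n * Real.sin (Real.pi * α) ^ 2 - m) :=
  -- LANDED: `Theorems/MobiusLadderLiouvilleOrthogonalTC0StubPhaseTail.lean` (p132288, wave c5)
  Summit.QuantumAdvantage.QuantumAdvantage.Theorems.LiouvilleOrthogonalTC0.stub_phaseTail n m α

/-- **Stub K1b (wave, v8) — small frequencies from the uniform Walsh bound.** From the tail bound of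
`stub_phaseTail` (hypothesis `hT`) and the tree's PROVED `WalshLiouvilleBound` (`∃ c > 0`: all Walsh
sums of `λ` on `n` digits are `≤ 2^{n−n^c}` eventually): there is `a > 0` (any `a < c/2` works; take
`R = ⌈3/c⌉₊`, level `k = ⌊n^{1/R}⌋₊`, `a = 1/(3R)`) such that for every `B`, eventually in `n`,
`|S_n(α)| ≤ 2ⁿ/n^B` for all `|α| ≤ n^{a−1/2}` — Green's splitting `GreenAC0.core_bound` for the real
and imaginary parts (`E₀ = E₁ = 2^{n−n^c}`, `τ = e^{2n sin²(πα) − (k+1)}`, `n sin²(πα) ≤ π² n^{2a}`). -/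
theorem stub_gelfondSmall_of_tail
    (hT : ∀ (n m : ℕ) (α : ℝ),
      tailWeight (fun y : Fin n → Bool =>
          Real.cos (2 * Real.pi * α * ((Finset.univ.filter fun i : Fin n => y i = true).card : ℝ))) m
          ≤ Real.exp (2 * n * Real.sin (Real.pi * α) ^ 2 - m) ∧
        tailWeight (fun y : Fin n → Bool =>
          Real.sin (2 * Real.pi * α * ((Finset.univ.filter fun i : Fin n => y i = true).card : ℝ))) m
          ≤ Real.exp (2 * n * Real.sin (Real.pi * α) ^ 2 - m)) :
    ∃ a : ℝ, 0 < a ∧ ∀ B : ℕ, ∀ᶠ n : ℕ in atTop, ∀ α : ℝ, |α| ≤ (n : ℝ) ^ (a - 1 / 2) →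
      ‖∑ N ∈ Finset.range (2 ^ n), ((ArithmeticFunction.liouville N : ℤ) : ℂ) *
            Complex.exp (((2 * Real.pi * α *
              ((Finset.univ.filter fun i : Fin n => Nat.testBit N i = true).card : ℝ) : ℝ) : ℂ) * Complex.I)‖ ≤ (2 : ℝ) ^ n / (n : ℝ) ^ B :=
  -- LANDED: `Theorems/MobiusLadderLiouvilleOrthogonalTC0StubGelfondSmall.lean` (p132581, wave c5)
  Summit.QuantumAdvantage.QuantumAdvantage.Theorems.LiouvilleOrthogonalTC0.stub_gelfondSmall_of_tail hT

/-- **Stub K3a (wave, v8) — discrete Parseval on the Hamming slices.** With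
`A_j = Σ_{N<2ⁿ, s₂(N)=j} λ(N)` and the Gelfond sums at the `n + 1` frequencies `k/(n+1)`:
`Σ_{j≤n} A_j² ≤ (n+1)⁻¹ Σ_{k≤n} |S_n(k/(n+1))|²` (in fact equality: expand `|S_n|²`, swap sums, and
`Σ_{k<M} e(k d/M) = M·[M ∣ d]` with `|d| = |s₂(N) − s₂(N')| ≤ n < M = n + 1`). -/
theorem stub_sliceL2 (n : ℕ) :
    ∑ j ∈ Finset.range (n + 1),
        (∑ N ∈ (Finset.range (2 ^ n)).filter
            (fun N => (Finset.univ.filter fun i : Fin n => Nat.testBit N i = true).card = j),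
          ((ArithmeticFunction.liouville N : ℤ) : ℝ)) ^ 2
      ≤ (∑ k ∈ Finset.range (n + 1),
          ‖∑ N ∈ Finset.range (2 ^ n), ((ArithmeticFunction.liouville N : ℤ) : ℂ) *
            Complex.exp (((2 * Real.pi * ((k : ℝ) / (n + 1)) *
              ((Finset.univ.filter fun i : Fin n => Nat.testBit N i = true).card : ℝ) : ℝ) : ℂ) * Complex.I)‖ ^ 2) / (n + 1) :=
  -- LANDED: `Theorems/MobiusLadderLiouvilleOrthogonalTC0StubSliceL2.lean` (p132817, wave c5)
  Summit.QuantumAdvantage.QuantumAdvantage.Theorems.LiouvilleOrthogonalTC0.stub_sliceL2 n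

/-- **Stub K3b (wave, v8) — few digit strings have atypical weight** (Hoeffding on the cube, cf.
`stub_cubeTail`): `#{N < 2ⁿ : t ≤ |s₂(N) − n/2|} ≤ 2·2ⁿ e^{−2t²/n}` for `t ≥ 0`. -/
theorem stub_sliceTail (n : ℕ) (t : ℝ) (ht : 0 ≤ t) :
    ((((Finset.range (2 ^ n)).filter fun N =>
        t ≤ |((Finset.univ.filter fun i : Fin n => Nat.testBit N i = true).card : ℝ) - n / 2|).card : ℕ) : ℝ)
      ≤ 2 * 2 ^ n * Real.exp (-(2 * t ^ 2 / n)) :=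
  -- LANDED: `Theorems/MobiusLadderLiouvilleOrthogonalTC0StubSliceTail.lean` (p132745, wave c5)
  Summit.QuantumAdvantage.QuantumAdvantage.Theorems.LiouvilleOrthogonalTC0.stub_sliceTail n t ht

/-- **Stub K3c (wave, v8) — the slice criterion.** From Parseval on the slices (`hL2`,
`stub_sliceL2`) and the weight tail (`hTail`, `stub_sliceTail`): for every `ε > 0`, eventually in `n`,
a UNIFORM bound `|S_n(k/(n+1))| ≤ 2ⁿ/n` at all `n + 1` frequencies forces
`|Σ_{N<2ⁿ} λ(N) G(s₂(N))| ≤ ε 2ⁿ` for every `G : ℕ → ℝ` with `|G| ≤ 1` (fibre over the weight: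
`≤ Σ_j |A_j|`; far slices `|j − n/2| ≥ t = √(n log(8/ε)/2)` carry `≤ 2·2ⁿe^{−2t²/n} ≤ ε2ⁿ/4` strings;
the `< 2t + 1` central ones give `≤ √(2t+1)·(Σ_j A_j²)^{1/2} ≤ √(2t+1)·2ⁿ/n ≤ ε 2ⁿ/2` eventually). -/
theorem stub_sliceCriterion_of
    (hL2 : ∀ n : ℕ,
      ∑ j ∈ Finset.range (n + 1),
          (∑ N ∈ (Finset.range (2 ^ n)).filter
              (fun N => (Finset.univ.filter fun i : Fin n => Nat.testBit N i = true).card = j),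
            ((ArithmeticFunction.liouville N : ℤ) : ℝ)) ^ 2
        ≤ (∑ k ∈ Finset.range (n + 1),
            ‖∑ N ∈ Finset.range (2 ^ n), ((ArithmeticFunction.liouville N : ℤ) : ℂ) *
            Complex.exp (((2 * Real.pi * ((k : ℝ) / (n + 1)) *
              ((Finset.univ.filter fun i : Fin n => Nat.testBit N i = true).card : ℝ) : ℝ) : ℂ) * Complex.I)‖ ^ 2) / (n + 1))
    (hTail : ∀ (n : ℕ) (t : ℝ), 0 ≤ t →
      ((((Finset.range (2 ^ n)).filter fun N =>
          t ≤ |((Finset.univ.filter fun i : Fin n => Nat.testBit N i = true).card : ℝ) - n / 2|).card : ℕ) : ℝ)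
        ≤ 2 * 2 ^ n * Real.exp (-(2 * t ^ 2 / n))) :
    ∀ ε : ℝ, 0 < ε → ∀ᶠ n : ℕ in atTop,
      (∀ k ∈ Finset.range (n + 1),
        ‖∑ N ∈ Finset.range (2 ^ n), ((ArithmeticFunction.liouville N : ℤ) : ℂ) *
            Complex.exp (((2 * Real.pi * ((k : ℝ) / (n + 1)) *
              ((Finset.univ.filter fun i : Fin n => Nat.testBit N i = true).card : ℝ) : ℝ) : ℂ) * Complex.I)‖ ≤ (2 : ℝ) ^ n / n) →
      ∀ G : ℕ → ℝ, (∀ j, |G j| ≤ 1) →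
        |∑ N ∈ Finset.range (2 ^ n), ((ArithmeticFunction.liouville N : ℤ) : ℝ) *
            G (Finset.univ.filter fun i : Fin n => Nat.testBit N i = true).card| ≤ ε * (2 : ℝ) ^ n :=
  -- LANDED: `Theorems/MobiusLadderLiouvilleOrthogonalTC0StubSliceCriterion.lean` (p132959, wave c5)
  Summit.QuantumAdvantage.QuantumAdvantage.Theorems.LiouvilleOrthogonalTC0.stub_sliceCriterion_of hL2 hTail

/-- **Stub (LEAD, v8) — the symmetric-digital rung.** From the small-frequency bound (`hSmall`, K1),
the LARGE-FREQUENCY HYPOTHESIS `hLarge` (= `GelfondLiouvilleDecay`, Mauduit–Rivat type, NOT proved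
in the tree) and the slice criterion (`hCrit`, K3): `λ` is orthogonal to every Boolean function of the
Hamming weight of the digits — for every `ε > 0`, eventually in `n`, for ALL `G : ℕ → Bool`,
`|Σ_{N<2ⁿ} λ(N) sgn G(s₂(N))| ≤ ε 2ⁿ` (at the frequency `k/(n+1)` use `hSmall`/`hLarge` with `B = 1`
at `k/(n+1)` if `≤ 1/2`, else at `k/(n+1) − 1`, by `1`-periodicity of `S_n`). -/
theorem stub_symmetricRung
    (hSmall : ∃ a : ℝ, 0 < a ∧ ∀ B : ℕ, ∀ᶠ n : ℕ in atTop, ∀ α : ℝ, |α| ≤ (n : ℝ) ^ (a - 1 / 2) →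
      ‖∑ N ∈ Finset.range (2 ^ n), ((ArithmeticFunction.liouville N : ℤ) : ℂ) *
            Complex.exp (((2 * Real.pi * α *
              ((Finset.univ.filter fun i : Fin n => Nat.testBit N i = true).card : ℝ) : ℝ) : ℂ) * Complex.I)‖ ≤ (2 : ℝ) ^ n / (n : ℝ) ^ B)
    (hLarge : ∀ a : ℝ, 0 < a → ∀ B : ℕ, ∀ᶠ n : ℕ in atTop, ∀ α : ℝ,
      (n : ℝ) ^ (a - 1 / 2) ≤ |α| → |α| ≤ 1 / 2 →
        ‖∑ N ∈ Finset.range (2 ^ n), ((ArithmeticFunction.liouville N : ℤ) : ℂ) *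
            Complex.exp (((2 * Real.pi * α *
              ((Finset.univ.filter fun i : Fin n => Nat.testBit N i = true).card : ℝ) : ℝ) : ℂ) * Complex.I)‖ ≤ (2 : ℝ) ^ n / (n : ℝ) ^ B)
    (hCrit : ∀ ε : ℝ, 0 < ε → ∀ᶠ n : ℕ in atTop,
      (∀ k ∈ Finset.range (n + 1),
        ‖∑ N ∈ Finset.range (2 ^ n), ((ArithmeticFunction.liouville N : ℤ) : ℂ) *
            Complex.exp (((2 * Real.pi * ((k : ℝ) / (n + 1)) *
              ((Finset.univ.filter fun i : Fin n => Nat.testBit N i = true).card : ℝ) : ℝ) : ℂ) * Complex.I)‖ ≤ (2 : ℝ) ^ n / n) →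
      ∀ G : ℕ → ℝ, (∀ j, |G j| ≤ 1) →
        |∑ N ∈ Finset.range (2 ^ n), ((ArithmeticFunction.liouville N : ℤ) : ℝ) *
            G (Finset.univ.filter fun i : Fin n => Nat.testBit N i = true).card| ≤ ε * (2 : ℝ) ^ n) :
    ∀ ε : ℝ, 0 < ε → ∀ᶠ n : ℕ in atTop, ∀ G : ℕ → Bool,
      |∑ N ∈ Finset.range (2 ^ n), ((ArithmeticFunction.liouville N : ℤ) : ℝ) *
          sgn (G (Finset.univ.filter fun i : Fin n => Nat.testBit N i = true).card)| ≤ ε * (2 : ℝ) ^ n :=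
  -- LANDED: `Theorems/MobiusLadderLiouvilleOrthogonalTC0StubSymmetricRung.lean` (p133033, lead c5)
  Summit.QuantumAdvantage.QuantumAdvantage.Theorems.LiouvilleOrthogonalTC0.stub_symmetricRung hSmall hLarge hCrit

/-- **The v8 case, packaged (lead):** under the large-frequency hypothesis `GelfondLiouvilleDecay`,
every Boolean function of the Hamming weight of the digits is asymptotically orthogonal to `λ`
(`stub_symmetricRung` ∘ `stub_gelfondSmall_of_tail` ∘ `stub_phaseTail`, `stub_sliceCriterion_of` ∘
`stub_sliceL2`, `stub_sliceTail`). Stated with the hypothesis as an antecedent INSIDE the eventuality,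
so that the composition can case on it. -/
theorem symmetricRung_eventually (ε : ℝ) (hε : 0 < ε) :
    ∀ᶠ n : ℕ in atTop, GelfondLiouvilleDecay → ∀ G : ℕ → Bool,
      |∑ N ∈ Finset.range (2 ^ n), ((ArithmeticFunction.liouville N : ℤ) : ℝ) *
          sgn (G (Finset.univ.filter fun i : Fin n => Nat.testBit N i = true).card)| ≤ ε * (2 : ℝ) ^ n := by
  by_cases hLarge : GelfondLiouvilleDecay
  · filter_upwards [stub_symmetricRung (stub_gelfondSmall_of_tail stub_phaseTail) hLarge
      (stub_sliceCriterion_of stub_sliceL2 stub_sliceTail) ε hε] with n hn _ G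
    exact hn G
  · exact Filter.Eventually.of_forall fun n h => absurd h hLarge


/-! ### Skeleton v8.1 (lead c5): the Möbius bridge — the crux IS Kalai's catalogued `TC⁰` conjecture

Not used by the composition (it concerns the crux as a whole, not a case of it): the route states rung R2
for `λ`; the printed open problem (`Literature.NumberTheory.LFunctions.kalai_moebius_TC0`, `@[conjecture]`)
is for `μ`. They are EQUIVALENT: `TC⁰`-orthogonality of a bounded `g` passes to `N ↦ Σ_{e²∣N} h(e) g(N/e²)`
(`stub_sqTransfer`: multiplication by the constant `e²` — `stub_dilate` — and comparison with a constant —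
`stub_decideLt` — are `TC⁰`/`AC⁰` maps; the `e > D₀` tail has `≤ 2ⁿ/D₀` terms — `stub_sqTail`), applied
along `λ = μ ∗ 𝟙_□` (`stub_lamOfMu`) and `μ = λ ∗ (μ ∘ √)` (`stub_muOfLam`). -/

/-- **Stub (wave, v8.1) — comparison with a constant in `AC⁰`** (LANDED p134473). -/
theorem stub_decideLt {B : Set GateFn} (hB : acBasis ⊆ B) (n X : ℕ) : ACRealOver B (fun x : Fin n → Bool => decide (∑ i : Fin n, (x i).toNat * 2 ^ (i : ℕ) < X)) 3 ((n + 1) ^ 2 + 1) :=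
  Summit.QuantumAdvantage.QuantumAdvantage.Theorems.LiouvilleOrthogonalTC0.stub_decideLt hB n X

/-- **Stub (wave, v8.1) — `λ(N) = Σ_{d²∣N} μ(N/d²)`** (LANDED p134502). -/
theorem stub_lamOfMu (N : ℕ) (hN : N ≠ 0) : (ArithmeticFunction.liouville N : ℤ) = ∑ d ∈ N.divisors.filter (fun d => d * d ∣ N), (ArithmeticFunction.moebius (N / (d * d)) : ℤ) :=
  Summit.QuantumAdvantage.QuantumAdvantage.Theorems.LiouvilleOrthogonalTC0.stub_lamOfMu N hN

/-- **Stub (wave, v8.1) — `μ(N) = Σ_{d²∣N} μ(d) λ(N/d²)`** (LANDED p134502). -/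
theorem stub_muOfLam (N : ℕ) (hN : N ≠ 0) : (ArithmeticFunction.moebius N : ℤ) = ∑ d ∈ N.divisors.filter (fun d => d * d ∣ N), (ArithmeticFunction.moebius d : ℤ) * ArithmeticFunction.liouville (N / (d * d)) :=
  Summit.QuantumAdvantage.QuantumAdvantage.Theorems.LiouvilleOrthogonalTC0.stub_muOfLam N hN

/-- **Stub (wave, v8.1) — the tail of large square divisors** (LANDED p134502). -/
theorem stub_sqTail (n D₀ : ℕ) (hD : 1 ≤ D₀) : (∑ N ∈ Finset.range (2 ^ n), (((N.divisors.filter fun d => d * d ∣ N ∧ D₀ < d).card : ℕ) : ℝ)) ≤ (2 : ℝ) ^ n / D₀ :=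
  Summit.QuantumAdvantage.QuantumAdvantage.Theorems.LiouvilleOrthogonalTC0.stub_sqTail n D₀ hD

/-- **Stub (LEAD, v8.1) — the square-divisor transfer** (LANDED p135042). -/
theorem stub_sqTransfer (g h : ℕ → ℤ) (hg : ∀ N, |g N| ≤ 1) (hh : ∀ d, |h d| ≤ 1) (hP : ∀ (d : ℕ) (p : Polynomial ℕ) (ε : ℝ), 0 < ε → ∀ᶠ n : ℕ in atTop, ∀ C : Circuit (Fin n), C.IsOver tcBasis → C.acDepth ≤ d → C.size ≤ p.eval n → |∑ N ∈ Finset.range (2 ^ n), ((g N : ℤ) : ℝ) * sgn (C.eval (fun i : Fin n => Nat.testBit N i))| ≤ ε * (2 : ℝ) ^ n) : ∀ (d : ℕ) (p : Polynomial ℕ) (ε : ℝ), 0 < ε → ∀ᶠ n : ℕ in atTop, ∀ C : Circuit (Fin n), C.IsOver tcBasis → C.acDepth ≤ d → C.size ≤ p.eval n → |∑ N ∈ Finset.range (2 ^ n), ((∑ e ∈ N.divisors.filter (fun e => e * e ∣ N), h e * g (N / (e * e)) : ℤ) : ℝ) * sgn (C.eval (fun i : Fin n => Nat.testBit N i))|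 ≤ ε * (2 : ℝ) ^ n :=
  Summit.QuantumAdvantage.QuantumAdvantage.Theorems.LiouvilleOrthogonalTC0.stub_sqTransfer g h hg hh hP

/-- **The bridge (lead, v8.1; LANDED p135119):** `LiouvilleOrthogonalTC0 ↔ kalai_moebius_TC0`. -/
theorem liouvilleOrthogonalTC0_iff_kalai :
    LiouvilleOrthogonalTC0 ↔ Literature.NumberTheory.LFunctions.kalai_moebius_TC0 :=
  Summit.QuantumAdvantage.QuantumAdvantage.Theorems.LiouvilleOrthogonalTC0.liouvilleOrthogonalTC0_iff_kalai


/-! ### Skeleton v9 (lead c6): three more rungs — top digits (Matomäki–Radziwiłł), finite-state scans (Müllner), narrow waist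

Three pieces of the v8 residue are earned, two of them from arithmetic inputs the ladder had not used:

* (R1, UNCONDITIONAL) the TOP-DIGITS RUNG `topDigitsRung`: for every non-decreasing unbounded `ψ`,
  `λ` is orthogonal to EVERY Boolean function of `⌊N/2^{ψ(n)}⌋`, i.e. of the digits above position
  `ψ(n)` — any circuit (any basis, depth, size) that ignores the lowest `ψ(n) → ∞` digits. Input: the
  tree's PROVED Matomäki–Radziwiłł theorem (`Literature.NumberTheory.Sieve.matomaki_radziwill_holds`:
  `λ` has cancellation in almost all short intervals `(x, x+h]`, `h → ∞`), turned into a statement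
  about ALIGNED dyadic blocks (`stub_alignedBlocks` ← `stub_windowAverage`: average the sliding windows
  of length `2^{⌊s/2⌋}` inside the aligned blocks of length `2^s`; the exceptional windows, the mean of
  `λ` on `[X, 2X]` (prime number theorem for `λ`, tree) and the ratio `2^{⌊s/2⌋-s}` are all `o(1)`),
  and the dyadic assembly `stub_topDigits` (scale `min(ψ j, j)` in the range `[2^j, 2^{j+1})`).
* (R2, conditional on the PRINTED theorem of C. Müllner, Duke Math. J. 166 (2017), Thm. 1.2 = tree
  named fact `mullner_moebius_automatic`, whose in-tree discharge programme `MauduitRivat*.lean` is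
  active) the FINITE-STATE-SCAN RUNG `scanRung_eventually`: for every fixed `S`, `λ` is orthogonal,
  uniformly in the automaton, to every Boolean function computed by an `S`-state automaton scanning the
  `n` input bits from `x₀` to `x_{n-1}` or from `x_{n-1}` to `x₀` (padding zeros included) — parity,
  `s₂(N) mod m`, `N mod q`, the Rudin–Shapiro sign, every digit-pattern detector: the first handled piece
  containing non-monotone depth-two/three majority circuits. The `λ`-form of Müllner's theorem needs NO
  unprinted hypothesis (`λ = 𝟙_□ ⋆ μ` and Cobham's closure under `m ↦ d²m`; tree
  `MobiusLadder.liouville_automatic_of_mullner`); uniformity over the automaton comes from the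
  finiteness of the family of `S`-state automata (`stub_automaticFamily`, both reading directions; the
  LSB-first automata are `2`-automatic by kernel finiteness), and padded scans of length `n` split along
  the binary length of `N` into members of the same family with modified output map / initial state
  (`stub_scanRung`).
* (R3, UNCONDITIONAL) the NARROW-WAIST RUNG `stub_waist`: any Boolean function `F` — a `MAJ`/`THR` gate,
  or any circuit whatsoever — of `K ≤ n^β` sub-circuits from the v7 few-majority class (poly size, depth
  `≤ d`, majority gates of fan-in `≥ 3` at the bottom and `≤ c₁ log n` of them): e.g. a majority vote
  among `n^β` `AC⁰` circuits. Sensitivity calculus: `sens_guess_le` (the sensitive blocks of `F ∘ (C_a)`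
  are covered by those of the `C_a`), `FewMajSens3.sens_fewMaj_le`, `stub_tailOfSens`, and the
  single-level spectral criterion `liouville_orthogonal_of_tailWeight_level`.

`stub_hyp_pos` remains the single `sorry`. Residue after v9 (unchanged in kind): depth `≥ 3` with large or
many majority gates reading the LOW digits, depth-two `MAJ ∘ THR` with `> n^α` bottom gates — where the
depth-two piece already contains "explicit `(1/2 - o(1))`-average-case lower bounds against polynomial-size
`MAJ ∘ MAJ`", open in circuit complexity (Kane–Williams, STOC 2016; Chen–Santhanam–Srinivasan, ToC 2018:
sizes `n^{3/2}`, `n^{5/2}` only).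
-/

/-- **Stub T1a (wave, v9) — averaging sliding windows inside aligned blocks.** For `|f| ≤ 1`,
`1 ≤ h ≤ H`, `h ≤ X` and the `M` aligned blocks `B_i = [X + iH, X + (i+1)H)`:
`h · Σ_i |Σ_{B_i} f| ≤ 2 Σ_{x ∈ [X-h, X+MH)} |Σ_{(x, x+h]} f| + 2h²M` — every `N ∈ B_i` lies in exactly
`h` windows `(x, x+h]`, `x ∈ [N-h, N-1] ⊆ [X+iH-h, X+(i+1)H)`; the `2h` windows not inside `B_i` err by
`≤ h` each; consecutive `x`-ranges overlap at most pairwise. -/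
theorem stub_windowAverage (f : ℕ → ℝ) (hf : ∀ N, |f N| ≤ 1) (X H h M : ℕ) (hh : 1 ≤ h)
    (hhH : h ≤ H) (hhX : h ≤ X) :
    (h : ℝ) * ∑ i ∈ Finset.range M, |∑ N ∈ Finset.Ico (X + i * H) (X + (i + 1) * H), f N|
      ≤ 2 * ∑ x ∈ Finset.Ico (X - h) (X + M * H), |∑ N ∈ Finset.Ioc x (x + h), f N|
        + 2 * (h : ℝ) ^ 2 * M :=
  -- LANDED: `Theorems/MobiusLadderLiouvilleOrthogonalTC0StubWindowAverage.lean` (p137878, wave c6)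
  Summit.QuantumAdvantage.QuantumAdvantage.Theorems.LiouvilleOrthogonalTC0.stub_windowAverage f hf X H h M hh hhH hhX

/-- **Stub T1b (LEAD, v9) — `λ` has cancellation on almost all ALIGNED dyadic blocks.** For every scale
function `s` with `s j ≤ j`, `s j → ∞`, and every `η > 0`: eventually in `j`, the `2^{j - s j}` aligned
blocks of length `2^{s j}` tiling `[2^j, 2^{j+1})` satisfy `Σ_i |Σ_{B_i} λ| ≤ η 2^j`. From the
Matomäki–Radziwiłł theorem for `λ` (tree, PROVED: `matomaki_radziwill_holds`, windows `(x, x+h]`,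
`h = h(X) → ∞`) with `h(X) = 2^{⌊s(log₂ X)/2⌋}`, the window average `hAvg` (`stub_windowAverage`), the
prime number theorem for `λ` (tree: `abs_sum_liouville_le_logPow`) for the mean on `[X, 2X]`, and
`2h/2^{s} ≤ 2^{1 - s/2} → 0`. -/
theorem stub_alignedBlocks
    (hAvg : ∀ (f : ℕ → ℝ), (∀ N, |f N| ≤ 1) → ∀ (X H h M : ℕ), 1 ≤ h → h ≤ H → h ≤ X →
      (h : ℝ) * ∑ i ∈ Finset.range M, |∑ N ∈ Finset.Ico (X + i * H) (X + (i + 1) * H), f N|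
        ≤ 2 * ∑ x ∈ Finset.Ico (X - h) (X + M * H), |∑ N ∈ Finset.Ioc x (x + h), f N|
          + 2 * (h : ℝ) ^ 2 * M)
    (s : ℕ → ℕ) (hs : ∀ j, s j ≤ j) (hs' : Tendsto s atTop atTop) (η : ℝ) (hη : 0 < η) :
    ∀ᶠ j : ℕ in atTop,
      (∑ i ∈ Finset.range (2 ^ (j - s j)),
        |∑ N ∈ Finset.Ico (2 ^ j + i * 2 ^ s j) (2 ^ j + (i + 1) * 2 ^ s j),
          (ArithmeticFunction.liouville N : ℝ)|) ≤ η * 2 ^ j :=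
  -- LANDED: `Theorems/MobiusLadderLiouvilleOrthogonalTC0StubAlignedBlocks.lean` (p138501, wave c6)
  Summit.QuantumAdvantage.QuantumAdvantage.Theorems.LiouvilleOrthogonalTC0.stub_alignedBlocks hAvg s hs hs' η hη

/-- **Stub T2 (wave, v9) — the top-digits rung from aligned blocks.** From the aligned-blocks statement
`hBlocks` (`stub_alignedBlocks`): for every non-decreasing unbounded `ψ` and `ε > 0`, eventually in `n`,
for ALL `G : ℕ → Bool`, `|Σ_{N<2ⁿ} λ(N) sgn G(⌊N/2^{ψ n}⌋)| ≤ ε 2ⁿ` — split `N < 2ⁿ` into `N < 2^{n-L}`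
(trivial) and the ranges `[2^j, 2^{j+1})`, `n - L ≤ j < n`; there `G(⌊N/2^{ψ n}⌋)` is constant on aligned
blocks of length `2^{ψ n}` (one block if `ψ n > j`), each a disjoint union of the blocks of scale
`min(ψ j, j) ≤ ψ n` (monotonicity), so the range contributes `≤ Σ_i |Σ_{B_i} λ| ≤ η 2^j`. -/
theorem stub_topDigits
    (hBlocks : ∀ s : ℕ → ℕ, (∀ j, s j ≤ j) → Tendsto s atTop atTop → ∀ η : ℝ, 0 < η →
      ∀ᶠ j : ℕ in atTop,
        (∑ i ∈ Finset.range (2 ^ (j - s j)),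
          |∑ N ∈ Finset.Ico (2 ^ j + i * 2 ^ s j) (2 ^ j + (i + 1) * 2 ^ s j),
            (ArithmeticFunction.liouville N : ℝ)|) ≤ η * 2 ^ j)
    (ψ : ℕ → ℕ) (hψ : Monotone ψ) (hψ' : Tendsto ψ atTop atTop) :
    ∀ ε : ℝ, 0 < ε → ∀ᶠ n : ℕ in atTop, ∀ G : ℕ → Bool,
      |∑ N ∈ Finset.range (2 ^ n), ((ArithmeticFunction.liouville N : ℤ) : ℝ) *
          sgn (G (N / 2 ^ ψ n))| ≤ ε * (2 : ℝ) ^ n :=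
  -- LANDED: `Theorems/MobiusLadderLiouvilleOrthogonalTC0StubTopDigits.lean` (p138891, wave c6)
  Summit.QuantumAdvantage.QuantumAdvantage.Theorems.LiouvilleOrthogonalTC0.stub_topDigits hBlocks ψ hψ hψ'

/-- **The top-digits rung (lead glue, v9; UNCONDITIONAL): `λ` is orthogonal to every Boolean function of
the digits above position `ψ(n)`, for every non-decreasing `ψ(n) → ∞`.** -/
theorem topDigitsRung (ψ : ℕ → ℕ) (hψ : Monotone ψ) (hψ' : Tendsto ψ atTop atTop) :
    ∀ ε : ℝ, 0 < ε → ∀ᶠ n : ℕ in atTop, ∀ G : ℕ → Bool,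
      |∑ N ∈ Finset.range (2 ^ n), ((ArithmeticFunction.liouville N : ℤ) : ℝ) *
          sgn (G (N / 2 ^ ψ n))| ≤ ε * (2 : ℝ) ^ n :=
  stub_topDigits (stub_alignedBlocks stub_windowAverage) ψ hψ hψ'

/-- **Stub A1 (wave, v9) — Müllner's theorem, `λ`-form, UNIFORMLY over the automata with `S` states.**
Assuming `mullner_moebius_automatic`: for every `S` and `ε > 0` there is `N₀` such that for all
`N ≥ N₀` and ALL `S`-state automata `(δ, q₀, τ)` reading the binary digits of `m` most-significant-first
(`(Nat.digits 2 m).reverse`, the tree's `dfaoSeq 2`) or least-significant-first (`Nat.digits 2 m`),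
`|Σ_{m ≤ N} λ(m) sgn τ(state)| ≤ ε N`. Each sequence is `2`-automatic (`isAutomaticSeq_dfaoSeq`; for the
LSB-first reading by kernel finiteness directly), so `MobiusLadder.liouville_automatic_of_mullner`
applies; the sequences depend on `δ` only through its values at the digits `0, 1`, so they range over a
FINITE family, and `N₀` is the maximum over it. -/
theorem stub_automaticFamily (hM : Literature.NumberTheory.LFunctions.mullner_moebius_automatic)
    (S : ℕ) (ε : ℝ) (hε : 0 < ε) :
    ∃ N₀ : ℕ, ∀ N : ℕ, N₀ ≤ N → ∀ (δ : Fin S → ℕ → Fin S) (q₀ : Fin S) (τ : Fin S → Bool),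
      |∑ m ∈ Finset.range (N + 1), (ArithmeticFunction.liouville m : ℝ) *
          sgn (τ ((Nat.digits 2 m).reverse.foldl δ q₀))| ≤ ε * N ∧
      |∑ m ∈ Finset.range (N + 1), (ArithmeticFunction.liouville m : ℝ) *
          sgn (τ ((Nat.digits 2 m).foldl δ q₀))| ≤ ε * N :=
  -- LANDED: `Theorems/MobiusLadderLiouvilleOrthogonalTC0StubAutomaticFamily.lean` (p138883, wave c6)
  Summit.QuantumAdvantage.QuantumAdvantage.Theorems.LiouvilleOrthogonalTC0.stub_automaticFamily hM S ε hε

/-- **Stub A3 (wave, v9) — padded finite-state scans of the `n` input bits.** From the uniform family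
bound `hFam` (`stub_automaticFamily`): for every `S` and `ε > 0`, eventually in `n`, for ALL `S`-state
automata `(δ, q₀, τ)` over the alphabet `Bool`, the function scanning the bits `x₀, x₁, …, x_{n-1}`
(`List.ofFn`, LSB first, the high zero bits included) and the one scanning `x_{n-1}, …, x₀` are both
`ε 2ⁿ`-orthogonal to `λ` on `N < 2ⁿ`. Split `N` by its binary length `j` (`2^{j-1} ≤ N < 2^j`): the
LSB scan then reads the digits of `N` followed by `n - j` zeros, i.e. it is the LSB automaton with output
map `τ ∘ δ(·,0)^{n-j}`; the MSB scan reads `n - j` zeros first, i.e. it is the MSB automaton started at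
`δ(·,0)^{n-j}(q₀)` — members of the same finite family; lengths `j ≤ n - L` cost `≤ 2^{n-L}`, the top
`L` lengths `≤ 2 · ε' 2^j` each. -/
theorem stub_scanRung
    (hFam : ∀ (S : ℕ) (ε : ℝ), 0 < ε →
      ∃ N₀ : ℕ, ∀ N : ℕ, N₀ ≤ N → ∀ (δ : Fin S → ℕ → Fin S) (q₀ : Fin S) (τ : Fin S → Bool),
        |∑ m ∈ Finset.range (N + 1), (ArithmeticFunction.liouville m : ℝ) *
            sgn (τ ((Nat.digits 2 m).reverse.foldl δ q₀))| ≤ ε * N ∧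
        |∑ m ∈ Finset.range (N + 1), (ArithmeticFunction.liouville m : ℝ) *
            sgn (τ ((Nat.digits 2 m).foldl δ q₀))| ≤ ε * N)
    (S : ℕ) : ∀ ε : ℝ, 0 < ε → ∀ᶠ n : ℕ in atTop,
      ∀ (δ : Fin S → Bool → Fin S) (q₀ : Fin S) (τ : Fin S → Bool),
        |∑ N ∈ Finset.range (2 ^ n), ((ArithmeticFunction.liouville N : ℤ) : ℝ) *
            sgn (τ (List.foldl δ q₀ (List.ofFn fun i : Fin n => Nat.testBit N i)))| ≤ ε * (2 : ℝ) ^ n ∧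
        |∑ N ∈ Finset.range (2 ^ n), ((ArithmeticFunction.liouville N : ℤ) : ℝ) *
            sgn (τ (List.foldl δ q₀ (List.ofFn fun i : Fin n => Nat.testBit N i).reverse))| ≤ ε * (2 : ℝ) ^ n :=
  -- LANDED: `Theorems/MobiusLadderLiouvilleOrthogonalTC0StubScanRung.lean` (p139014, wave c6)
  Summit.QuantumAdvantage.QuantumAdvantage.Theorems.LiouvilleOrthogonalTC0.stub_scanRung hFam S

/-- **The finite-state-scan rung, packaged (lead glue, v9):** under Müllner's theorem, every Boolean
function computed by an `S`-state automaton scanning the input bits (either direction) is asymptotically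
orthogonal to `λ`, uniformly in the automaton. Stated with the named fact as an antecedent INSIDE the
eventuality, so that the composition can case on it. -/
theorem scanRung_eventually (S : ℕ) (ε : ℝ) (hε : 0 < ε) :
    ∀ᶠ n : ℕ in atTop, Literature.NumberTheory.LFunctions.mullner_moebius_automatic →
      ∀ (δ : Fin S → Bool → Fin S) (q₀ : Fin S) (τ : Fin S → Bool),
        |∑ N ∈ Finset.range (2 ^ n), ((ArithmeticFunction.liouville N : ℤ) : ℝ) *
            sgn (τ (List.foldl δ q₀ (List.ofFn fun i : Fin n => Nat.testBit N i)))| ≤ ε * (2 : ℝ) ^ n ∧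
        |∑ N ∈ Finset.range (2 ^ n), ((ArithmeticFunction.liouville N : ℤ) : ℝ) *
            sgn (τ (List.foldl δ q₀ (List.ofFn fun i : Fin n => Nat.testBit N i).reverse))| ≤ ε * (2 : ℝ) ^ n := by
  by_cases hM : Literature.NumberTheory.LFunctions.mullner_moebius_automatic
  · filter_upwards [stub_scanRung (fun S' ε' hε' => stub_automaticFamily hM S' ε' hε') S ε hε]
      with n hn _ δ q₀ τ
    exact hn δ q₀ τ
  · exact Filter.Eventually.of_forall fun n h => absurd h hM

/-- **Stub W1 (wave, v9) — the narrow-waist rung (UNCONDITIONAL).** There are `β > 0` and `c₁ > 0` such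
that for every depth `d`, size polynomial `p` and `ε > 0`, eventually in `n`: for every `K ≤ n^β`, every
Boolean function `F` of `K` bits and every `K` circuits `C_a` over `tcBasis` with `acDepth ≤ d`,
`size ≤ p(n)`, all majority gates of fan-in `≥ 3` at `acWeight`-depth `≤ 1` and at most `c₁ log n` of
them (the v7 few-majority class), `|Σ_{N<2ⁿ} λ(N) sgn F(C_1(bits N), …, C_K(bits N))| ≤ ε 2ⁿ`. Proof:
the sensitive blocks of `F ∘ (C_a)_a` are covered by those of the `C_a` (`FewMajSens.sens_guess_le` with
constant guesses), each `C_a` has `≤ k_a 2ⁿ√m + 2^{k_a} 2ⁿ Φ(d, p(n))` of them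
(`FewMajSens3.sens_fewMaj_le`), so `W^{≥m} ≤ 3K(c₁ log n + n^{c₁ log 2} Φ/√m)/√m` (`stub_tailOfSens`),
which at the level `m = ⌊n^{1/R}⌋₊ + 1` of `liouville_orthogonal_of_tailWeight_level` is `≤ (ε/3)²`
for `β, c₁` small against `1/R` (`R = ⌈3/c⌉₊`, `c` = Bourgain's exponent). -/
theorem stub_waist : ∃ β : ℝ, 0 < β ∧ ∃ c₁ : ℝ, 0 < c₁ ∧ ∀ (d : ℕ) (p : Polynomial ℕ) (ε : ℝ), 0 < ε →
    ∀ᶠ n : ℕ in atTop, ∀ K : ℕ, (K : ℝ) ≤ (n : ℝ) ^ β → ∀ (F : (Fin K → Bool) → Bool)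
      (Cs : Fin K → Circuit (Fin n)),
      (∀ a, (Cs a).IsOver tcBasis ∧ (Cs a).acDepth ≤ d ∧ (Cs a).size ≤ p.eval n ∧
        (∀ (j : ℕ) (hj : j < (Cs a).gates.length), (∃ k, 3 ≤ k ∧ ((Cs a).gates[j]).fn = GateFn.maj k) →
          (GateList.wdepths acWeight (Cs a).gates).getD j 0 ≤ 1) ∧
        (((Finset.univ.filter fun j : Fin (Cs a).gates.length =>
            3 ≤ ((Cs a).gates[j]).arity ∧ ((Cs a).gates[j]).fn = GateFn.maj ((Cs a).gates[j]).arity).card : ℝ)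
          ≤ c₁ * Real.log n)) →
      |∑ N ∈ Finset.range (2 ^ n), ((ArithmeticFunction.liouville N : ℤ) : ℝ) *
          sgn (F (fun a => (Cs a).eval (fun i : Fin n => Nat.testBit N i)))| ≤ ε * (2 : ℝ) ^ n :=
  -- LANDED: `Theorems/MobiusLadderLiouvilleOrthogonalTC0StubWaist.lean` (p139149, wave c6)
  Summit.QuantumAdvantage.QuantumAdvantage.Theorems.LiouvilleOrthogonalTC0.stub_waist

/-- **Stub (wave 2, v9.1) — the two-ends rung at `√n` (UNCONDITIONAL; LANDED p139952).** There is
`c > 0` such that for every `ε > 0`, eventually in `n`, for all `k, m` with `k + m ≤ c√n` and every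
`1`-bounded `g`, `|Σ_{N<2ⁿ} λ(N) g(N mod 2^k, ⌊N/2^{n-m}⌋)| ≤ ε 2ⁿ`: `λ` is orthogonal to every function of
the lowest `k` and the highest `m` binary digits (Green's prime number theorem for `λ` twisted by the
characters to `2`-power moduli, no exceptional zero; sharpening `(k+m)³ ≤ n` of the sibling crux's
`DigitPolyUniformity.Sketch.stub_ends`). -/
theorem stub_ends_sqrt : ∃ c : ℝ, 0 < c ∧ ∀ ε : ℝ, 0 < ε → ∀ᶠ n : ℕ in atTop, ∀ k m : ℕ,
    ((k : ℝ) + m) ≤ c * Real.sqrt n →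
      ∀ g : ℕ → ℕ → ℝ, (∀ a j, |g a j| ≤ 1) →
        |∑ N ∈ Finset.range (2 ^ n), (ArithmeticFunction.liouville N : ℝ) * g (N % 2 ^ k) (N / 2 ^ (n - m))| ≤ ε * 2 ^ n :=
  -- LANDED: `Theorems/MobiusLadderLiouvilleOrthogonalTC0StubEndsSqrt.lean` (p139952, wave 2 of lead c6)
  Summit.QuantumAdvantage.QuantumAdvantage.Theorems.LiouvilleOrthogonalTC0.stub_ends_sqrt

/-! μ-twins (wave 2, v9.1, LANDED, not imported here — they do not feed the `λ`-composition):
`stub_topDigits_moebius` (p140051, `…StubTopDigitsMoebius.lean`, Matomäki–Radziwiłł for `μ`, unconditional) and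
`stub_scan_moebius` (p139966, `…StubScanMoebius.lean`, Müllner natively); Kalai forms
`moebius_orthogonal_circuit_topDigits` / `moebius_orthogonal_circuit_scan(MSB)_of_mullner` in
`…MoebiusTopDigitsScan.lean`. -/

/-- `Nat.log 2` is non-decreasing and unbounded (the default `ψ` of the composition's top-digits case). -/
theorem natLog_two_mono_tendsto : Monotone (Nat.log 2) ∧ Tendsto (Nat.log 2) atTop atTop := by
  refine ⟨fun a b h => Nat.log_mono_right h, ?_⟩
  refine Filter.tendsto_atTop_atTop.2 fun b => ⟨2 ^ b, fun a ha => ?_⟩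
  calc b = Nat.log 2 (2 ^ b) := (Nat.log_pow (by norm_num) b).symm
    _ ≤ Nat.log 2 a := Nat.log_mono_right ha



/-! ### Skeleton v10 (lead c6, cycle 2): the PTF RUNG — polynomial threshold functions of bounded degree (UNCONDITIONAL)

`λ` is orthogonal to every POLYNOMIAL THRESHOLD FUNCTION of bounded degree in the digits:
`x ↦ [p(x) ≥ 0]` for a real function `p` on the cube of Fourier–Walsh degree `≤ d` (tree
`fourierDegree`), `d` fixed — e.g. a majority vote (any integer weights) among polynomially many
`AND`/`OR` gates of fan-in `≤ d`, the sign of a real quadratic form in the bits (`d = 2`), every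
depth-two `THR ∘ {gates of fan-in ≤ d}` circuit. Input: the ELEMENTARY Fourier-analytic bound of
Diakonikolas–Raghavendra–Servedio–Tan (SIAM J. Comput. 43 (2014) = arXiv:0909.5011, Theorem 1.2 and
§6, Lemmas 6.1–6.2, Theorem 6.4): every degree-`d` PTF on `m` Boolean variables has average sensitivity
`AS(f) ≤ 2 m^{1−1/2^d}` (recursion `AS(m,d) ≤ √(m + m·AS(m,d−1))` through the formal derivatives
`D_j p`, which are degree-`(d−1)` PTFs), PROVED here in counting form (`stub_drstRecursion`,
`stub_drstAS`); degree-`d` PTFs are closed under the block reparametrisation `x = x₀ ⊕ ω∘π` of the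
line's sensitivity engine, so every `m`-partition has `≤ 2 m^{1−1/2^d} 2ⁿ` (point, pivotal block)
pairs (`stub_ptfBlock`), the Fourier tail above level `m` is `≤ 6 m^{−1/2^d}` (`stub_tailOfSens`),
uniformly in `n`, and the spectral criterion `stub_spectral` applies (`stub_ptfRung`). The depth-two
residue `MAJ ∘ THR` thereby loses its bounded-bottom-fan-in part (the classical first case of every
depth-two threshold lower bound, Goldmann–Håstad–Razborov / Hajnal et al.).
-/

/-- **Stub P1a (wave 3, v10) — the Diakonikolas–Raghavendra–Servedio–Tan recursion** (arXiv:0909.5011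
§6, Lemmas 6.1, 6.2 and Theorem 6.4, counting form, for EVERY real `q` on the cube `Fin m → Bool`):
with `piv(q) = Σ_ω #{i : [0 ≤ q ω] ≠ [0 ≤ q (ω with bit i flipped)]}` (`= 2^m · AS(sgn q)`) and the
formal derivative `D_j q (ω) = sgn(ω j)·(q ω − q ω^{(j)})/2` (independent of `ω j`):
`piv(q)² ≤ 2^m (m 2^m + Σ_j piv(D_j q))` — Lemma 6.2 `Inf_i(sgn q) = E[sgn q · x_i · sgn(D_i q)]`,
Cauchy–Schwarz, and Lemma 6.1 `E[x_i x_j f g] ≤ (Inf_i g + Inf_j f)/2` for `f ⟂ x_i`, `g ⟂ x_j`. -/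
theorem stub_drstRecursion (m : ℕ) (q : (Fin m → Bool) → ℝ) :
    (∑ ω : Fin m → Bool, ((Finset.univ.filter fun i : Fin m =>
        decide (0 ≤ q ω) ≠ decide (0 ≤ q (Function.update ω i (!ω i)))).card : ℝ)) ^ 2
      ≤ (2 : ℝ) ^ m * ((m : ℝ) * (2 : ℝ) ^ m +
          ∑ j : Fin m, ∑ ω : Fin m → Bool, ((Finset.univ.filter fun i : Fin m =>
            decide (0 ≤ sgn (ω j) * (q ω - q (Function.update ω j (!ω j)))) ≠
            decide (0 ≤ sgn (Function.update ω i (!ω i) j) *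
              (q (Function.update ω i (!ω i)) -
                q (Function.update (Function.update ω i (!ω i)) j
                  (!(Function.update ω i (!ω i) j)))))).card : ℝ)) := by
  sorry

/-- **Stub P1b (wave 3, v10) — DRST Theorem 1.2 in counting form:** every real `q` on `Fin m → Bool` of
Fourier–Walsh degree `≤ d` has `piv(q) ≤ 2 m^{1−1/2^d} 2^m` (average sensitivity of the degree-`d` PTF
`[q ≥ 0]` at most `2 m^{1−1/2^d}`): induction on `d` with the recursion `hRec` (`stub_drstRecursion`),
`deg(D_j q) ≤ deg(q) − 1` (the coefficient of `D_j q` at `S ∌ j` is `q̂(S ∪ {j})`, at `S ∋ j` it is `0`),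
degree `0` = constant, and `m + 2m^{2−1/2^d} ≤ 4 m^{2−1/2^d}`. -/
theorem stub_drstAS
    (hRec : ∀ (m : ℕ) (q : (Fin m → Bool) → ℝ),
      (∑ ω : Fin m → Bool, ((Finset.univ.filter fun i : Fin m =>
          decide (0 ≤ q ω) ≠ decide (0 ≤ q (Function.update ω i (!ω i)))).card : ℝ)) ^ 2
        ≤ (2 : ℝ) ^ m * ((m : ℝ) * (2 : ℝ) ^ m +
            ∑ j : Fin m, ∑ ω : Fin m → Bool, ((Finset.univ.filter fun i : Fin m =>
              decide (0 ≤ sgn (ω j) * (q ω - q (Function.update ω j (!ω j)))) ≠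
              decide (0 ≤ sgn (Function.update ω i (!ω i) j) *
                (q (Function.update ω i (!ω i)) -
                  q (Function.update (Function.update ω i (!ω i)) j
                    (!(Function.update ω i (!ω i) j)))))).card : ℝ)))
    (m d : ℕ) (q : (Fin m → Bool) → ℝ) (hq : fourierDegree q ≤ d) :
    ∑ ω : Fin m → Bool, ((Finset.univ.filter fun i : Fin m =>
        decide (0 ≤ q ω) ≠ decide (0 ≤ q (Function.update ω i (!ω i)))).card : ℝ)
      ≤ 2 * (m : ℝ) ^ ((1 : ℝ) - 1 / 2 ^ d) * (2 : ℝ) ^ m := by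
  sorry

/-- **Stub P2 (wave 3, v10) — block sensitivity of degree-`d` PTFs.** From the average-sensitivity
bound `hAS` (`stub_drstAS`): for every real `p` on `Fin n → Bool` of degree `≤ d` and every block
labelling `π : Fin n → Fin m`, `Σ_x #{j : [0 ≤ p x] ≠ [0 ≤ p (x with block π⁻¹(j) flipped)]} ≤ 2 m^{1−1/2^d} 2ⁿ`:
reparametrise `x = x₀ ⊕ ω∘π` (a `2^m`-fold cover of the cube; flipping block `j` of `x` is flipping bit
`j` of `ω`, cf. `sum_card_blockFlip_le_of_unate`), and observe that the fibre function
`ω ↦ p(x₀ ⊕ ω∘π)` has degree `≤ d` (`χ_T(x₀ ⊕ ω∘π) = χ_T(x₀) χ_{U_T}(ω)`, `U_T = {j : #(T ∩ π⁻¹ j) odd}`,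
`|U_T| ≤ |T|`). -/
theorem stub_ptfBlock
    (hAS : ∀ (m d : ℕ) (q : (Fin m → Bool) → ℝ), fourierDegree q ≤ d →
      ∑ ω : Fin m → Bool, ((Finset.univ.filter fun i : Fin m =>
          decide (0 ≤ q ω) ≠ decide (0 ≤ q (Function.update ω i (!ω i)))).card : ℝ)
        ≤ 2 * (m : ℝ) ^ ((1 : ℝ) - 1 / 2 ^ d) * (2 : ℝ) ^ m)
    {n m d : ℕ} (p : (Fin n → Bool) → ℝ) (hp : fourierDegree p ≤ d) (π : Fin n → Fin m) :
    ∑ x : Fin n → Bool, ((Finset.univ.filter fun j : Fin m =>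
        decide (0 ≤ p x) ≠ decide (0 ≤ p (fun i => xor (x i) (decide (π i = j))))).card : ℝ)
      ≤ 2 * (m : ℝ) ^ ((1 : ℝ) - 1 / 2 ^ d) * (2 : ℝ) ^ n := by
  sorry

/-- **Stub P3 (wave 3, v10) — the PTF rung.** From the block bound `hBS` (`stub_ptfBlock`): for every
`d` and `ε > 0`, eventually in `n`, for every real `p` on the `n` digits of degree `≤ d` and `b : Bool`,
`|Σ_{N<2ⁿ} λ(N) sgn(b ⊕ [0 ≤ p(bits N)])| ≤ ε 2ⁿ` — `stub_tailOfSens` with `B = 2 m^{1/2−1/2^d}` gives the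
Fourier tail `≤ 6 m^{−1/2^d} ≤ 6 m^{−1/2^{d+1}} =: τ(m)` (also `≥ 1 ≥` tail for `m ≤ 9`), `τ → 0`, and the
uniform spectral criterion `stub_spectral`; `b = true` only changes the sign of the sum. -/
theorem stub_ptfRung
    (hBS : ∀ (n m d : ℕ) (p : (Fin n → Bool) → ℝ), fourierDegree p ≤ d → ∀ π : Fin n → Fin m,
      ∑ x : Fin n → Bool, ((Finset.univ.filter fun j : Fin m =>
          decide (0 ≤ p x) ≠ decide (0 ≤ p (fun i => xor (x i) (decide (π i = j))))).card : ℝ)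
        ≤ 2 * (m : ℝ) ^ ((1 : ℝ) - 1 / 2 ^ d) * (2 : ℝ) ^ n)
    (d : ℕ) : ∀ ε : ℝ, 0 < ε → ∀ᶠ n : ℕ in atTop, ∀ (p : (Fin n → Bool) → ℝ), fourierDegree p ≤ d →
      ∀ b : Bool, |∑ N ∈ Finset.range (2 ^ n), ((ArithmeticFunction.liouville N : ℤ) : ℝ) *
          sgn (xor b (decide (0 ≤ p (fun i : Fin n => Nat.testBit N i))))| ≤ ε * (2 : ℝ) ^ n := by
  sorry

/-- **The PTF rung (lead glue, v10; UNCONDITIONAL once P1a–P3 land): `λ` is orthogonal to every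
polynomial threshold function of degree `≤ d` in the binary digits.** -/
theorem ptfRung (d : ℕ) : ∀ ε : ℝ, 0 < ε → ∀ᶠ n : ℕ in atTop, ∀ (p : (Fin n → Bool) → ℝ),
    fourierDegree p ≤ d → ∀ b : Bool,
      |∑ N ∈ Finset.range (2 ^ n), ((ArithmeticFunction.liouville N : ℤ) : ℝ) *
          sgn (xor b (decide (0 ≤ p (fun i : Fin n => Nat.testBit N i))))| ≤ ε * (2 : ℝ) ^ n :=
  stub_ptfRung (fun _ _ _ p hp π => stub_ptfBlock (fun m d q hq => stub_drstAS stub_drstRecursion m d q hq) p hp π) d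

/-! ### Skeleton v10 (lead c6, cycle 2): the PERIODIC RUNG (UNCONDITIONAL)

`λ` is orthogonal, uniformly, to every `q`-periodic function of `N` with `q ≤ n^A` — every function of
`N mod q` for every modulus up to any fixed power of the bit length (odd `q` is the new content; `q = 2^k`
is the low-digits case). Input: the tree's PROVED Siegel–Walfisz theorem for `λ` in arithmetic
progressions (`Literature.NumberTheory.LFunctions.SiegelWalfiszMoebius_holds` — Montgomery–Vaughan
§11.3 Ex. 13(f), assembled in the tree from the zero-free region — and its Liouville corollary
`SiegelWalfiszMoebius.liouville_progression`: `|Σ_{N ≤ x, N ≡ a (q)} λ(N)| ≤ C x/(log x)^B` for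
`q ≤ (log x)^A`). A function of `N mod q` is a function of the poly-bounded weighted digit sum
`Σᵢ xᵢ (2ⁱ mod q) < n q`, i.e. a depth-two `MAJ ∘ MAJ` circuit of size `O(n q)` with `≍ n q ≫ n^α` jumps —
inside the depth-two residue of v5–v9, and not a polynomial threshold function of bounded degree.
-/

/-- **Stub P4 (wave 3, v10) — the periodic rung (UNCONDITIONAL).** For every `A` and `ε > 0`,
eventually in `n`: for every modulus `1 ≤ q ≤ n^A` and every `1`-bounded `g : ℕ → ℝ`,
`|Σ_{N<2ⁿ} λ(N) g(N mod q)| ≤ ε 2ⁿ`. Split the sum into the `q` residue classes `N ≡ a (mod q)` and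
bound each class by the tree's PROVED Siegel–Walfisz theorem for `λ`
(`SiegelWalfiszMoebius_holds.liouville_progression` with exponents `A + 1` and `B = A + 1`, at
`x = 2ⁿ - 1 ≥ 2`, `log x ≥ n log 2 / 2`, so `q ≤ n^A ≤ (log x)^{A+1}` eventually): the total is
`≤ q · C x/(log x)^{A+1} ≤ C' 2ⁿ/n ≤ ε 2ⁿ` eventually (`λ(0) = 0` handles the term `N = 0`). -/
theorem stub_periodic (A : ℕ) : ∀ ε : ℝ, 0 < ε → ∀ᶠ n : ℕ in atTop, ∀ q : ℕ, 1 ≤ q → q ≤ n ^ A →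
    ∀ g : ℕ → ℝ, (∀ a, |g a| ≤ 1) →
      |∑ N ∈ Finset.range (2 ^ n), (ArithmeticFunction.liouville N : ℝ) * g (N % q)| ≤ ε * 2 ^ n := by
  sorry


/-! ### The composition -/

/-- **Composition (v10)**: the line concludes the crux BY NAME. Constant size polynomial: the
bounded-size rung `stub_sizeLe` (no hypothesis). Otherwise per circuit: a circuit computing a SYMMETRIC
function of the digits, when the analytic hypothesis `GelfondLiouvilleDecay` holds, by the symmetric-digital
rung `symmetricRung_eventually` (v8); a circuit ignoring the digits below position `⌊log₂ n⌋` by the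
UNCONDITIONAL top-digits rung `topDigitsRung` (v9, Matomäki–Radziwiłł); a circuit reading only the lowest `k` and the top `m`
digits, `k + m ≤ c₂√n`, by the UNCONDITIONAL two-ends rung `stub_ends_sqrt` (Green's character sums to
`2`-power moduli, sharpening the sibling crux's `DigitPolyUniformity.Sketch.stub_ends`); a circuit computed by a
`d`-state automaton scanning the bits `x₀ … x_{n-1}` or `x_{n-1} … x₀`, when Müllner's theorem
`mullner_moebius_automatic` holds, by the finite-state-scan rung `scanRung_eventually` (v9); a Boolean function of `≤ n^β` few-majority sub-circuits by
the UNCONDITIONAL narrow-waist rung `stub_waist` (v9); a polynomial threshold function of degree `≤ d` by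
the PTF rung `ptfRung` (v10, unconditional once its stubs land); a `q`-periodic function of `N`, `q ≤ n^d`, by the
UNCONDITIONAL periodic rung `stub_periodic` (v10, Siegel–Walfisz for `λ`); depth `≤ 1` by the proved
threshold rung `stub_depthOne`; depth `≤ 2` by the depth-two normal form `stub_depthTwo_nf` — an
`∧/∨` top gate by the Kane rung `stub_orLtf` (v6), a majority top gate over `≤ n^α` distinct threshold
gates by the landed `LtfCombinationPoly` rung; no majority gate by the proved `AC⁰` rung
(`Theorems.LiouvilleOrthogonalAC0_proof`); all majority fan-ins `k` with `2^k ≤ n^d` by the proved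
small-fan-in rung `stub_smallMaj`; few bottom majority gates by the few-majority rung `stub_fewMaj` (v7);
otherwise — depth `≥ 3`, or depth `2` under a majority of more than `n^α` threshold gates; some majority gate
of fan-in `> d log₂ n`; size polynomial of degree `≥ 1` — by the transfer `stub_transfer_pos` from the open
hypothesis `stub_hyp_pos`. -/
theorem LiouvilleOrthogonalTC0_of : LiouvilleOrthogonalTC0 := by
  obtain ⟨δ₀, κ, Λ₀, hδ₀, hκ, hΛ₀, h⟩ := stub_hyp_pos
  have hAC := Summit.QuantumAdvantage.QuantumAdvantage.Theorems.LiouvilleOrthogonalAC0_proof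
  have hTR := stub_transfer_pos δ₀ κ Λ₀ hδ₀ hκ hΛ₀ h
  obtain ⟨α, hα, hLC⟩ :=
    Summit.QuantumAdvantage.QuantumAdvantage.Theorems.LiouvilleOrthogonalTC0.liouville_orthogonal_ltf_combination_poly
  obtain ⟨c₀, hc₀, hFM⟩ := stub_fewMaj
  obtain ⟨β, hβ, c₁, hc₁, hWA⟩ := stub_waist
  obtain ⟨c₂, hc₂, hEN⟩ := stub_ends_sqrt
  unfold Summit.QuantumAdvantage.QuantumAdvantage.Theses.MobiusLadder.LiouvilleOrthogonalAC0 at hAC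
  unfold Summit.QuantumAdvantage.QuantumAdvantage.Theses.MobiusLadder.LiouvilleOrthogonalTC0 at hTR ⊢
  intro d p ε hε
  by_cases hp : p.natDegree = 0
  · -- constant size polynomial: the bounded-size rung (v5), no hypothesis
    filter_upwards [stub_sizeLe (p.coeff 0) ε hε] with n hn C hB _ hs
    rw [Polynomial.eq_C_of_natDegree_eq_zero hp, Polynomial.eval_C] at hs
    exact hn C hB hs
  filter_upwards [stub_depthOne ε hε, hAC d p ε hε, stub_smallMaj d d p ε hε, hTR d p ε hε,
    stub_orLtf (p.natDegree + 2) ε hε, hLC ε hε, eventually_eval_add_le_pow p, hFM d p ε hε,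
    symmetricRung_eventually ε hε,
    topDigitsRung (Nat.log 2) natLog_two_mono_tendsto.1 natLog_two_mono_tendsto.2 ε hε,
    scanRung_eventually d ε hε, hWA d p ε hε,
    hEN ε hε, ptfRung d ε hε, stub_periodic d ε hε]
    with n h₁ h₂ h₄ h₃ h₅ h₆ hpn h₇ h₈ h₉ h₁₀ h₁₁ h₁₂ h₁₃ h₁₄ C hB hd hs
  by_cases hSym : GelfondLiouvilleDecay ∧
      ∃ G : ℕ → Bool, ∀ x : Fin n → Bool, C.eval x = G (Finset.univ.filter fun i : Fin n => x i = true).card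
  · -- (v8) a SYMMETRIC circuit (any depth and size), under the analytic hypothesis `GelfondLiouvilleDecay`
    obtain ⟨hGel, G, hG⟩ := hSym
    simp only [hG]
    exact h₈ hGel G
  by_cases hTop : ∃ G : ℕ → Bool, ∀ N : ℕ, N < 2 ^ n →
      C.eval (fun i : Fin n => Nat.testBit N i) = G (N / 2 ^ Nat.log 2 n)
  · -- (v9, UNCONDITIONAL) a circuit ignoring the digits below position `⌊log₂ n⌋`: the top-digits rung (Matomäki–Radziwiłł)
    obtain ⟨G, hG⟩ := hTop
    rw [Finset.sum_congr rfl fun N hN => by rw [hG N (Finset.mem_range.1 hN)]]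
    exact h₉ G
  by_cases hEnds : ∃ k m : ℕ, ((k : ℝ) + m) ≤ c₂ * Real.sqrt n ∧ ∃ g : ℕ → ℕ → Bool, ∀ N : ℕ, N < 2 ^ n →
      C.eval (fun i : Fin n => Nat.testBit N i) = g (N % 2 ^ k) (N / 2 ^ (n - m))
  · -- (v9.1, UNCONDITIONAL) a circuit reading only the lowest `k` and the top `m` digits, `k + m ≤ c₂√n`: the two-ends rung
    -- (Green's character sums to 2-power moduli; `stub_ends_sqrt`, sharpening the sibling crux's `stub_ends`)
    obtain ⟨k, m, hkm, g, hg⟩ := hEnds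
    rw [Finset.sum_congr rfl fun N hN => by rw [hg N (Finset.mem_range.1 hN)]]
    exact h₁₂ k m hkm (fun a j => sgn (g a j)) (fun a j => by unfold sgn; split_ifs <;> simp)
  by_cases hScan : Literature.NumberTheory.LFunctions.mullner_moebius_automatic ∧
      ∃ (δ : Fin d → Bool → Fin d) (q₀ : Fin d) (τ : Fin d → Bool),
        ∀ x : Fin n → Bool, C.eval x = τ (List.foldl δ q₀ (List.ofFn x))
  · -- (v9) a `d`-state automaton scanning the bits `x₀ … x_{n-1}`, under Müllner's theorem: the finite-state-scan rung
    obtain ⟨hMu, δ, q₀, τ, hC⟩ := hScan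
    simp only [hC]
    exact (h₁₀ hMu δ q₀ τ).1
  by_cases hScanM : Literature.NumberTheory.LFunctions.mullner_moebius_automatic ∧
      ∃ (δ : Fin d → Bool → Fin d) (q₀ : Fin d) (τ : Fin d → Bool),
        ∀ x : Fin n → Bool, C.eval x = τ (List.foldl δ q₀ (List.ofFn x).reverse)
  · -- (v9) a `d`-state automaton scanning the bits `x_{n-1} … x₀` (most significant first), under Müllner's theorem
    obtain ⟨hMu, δ, q₀, τ, hC⟩ := hScanM
    simp only [hC]
    exact (h₁₀ hMu δ q₀ τ).2
  by_cases hWaist : ∃ K : ℕ, (K : ℝ) ≤ (n : ℝ) ^ β ∧ ∃ (F : (Fin K → Bool) → Bool)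
      (Cs : Fin K → Circuit (Fin n)),
      (∀ a, (Cs a).IsOver tcBasis ∧ (Cs a).acDepth ≤ d ∧ (Cs a).size ≤ p.eval n ∧
        (∀ (j : ℕ) (hj : j < (Cs a).gates.length), (∃ k, 3 ≤ k ∧ ((Cs a).gates[j]).fn = GateFn.maj k) →
          (GateList.wdepths acWeight (Cs a).gates).getD j 0 ≤ 1) ∧
        (((Finset.univ.filter fun j : Fin (Cs a).gates.length =>
            3 ≤ ((Cs a).gates[j]).arity ∧ ((Cs a).gates[j]).fn = GateFn.maj ((Cs a).gates[j]).arity).card : ℝ)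
          ≤ c₁ * Real.log n)) ∧
      ∀ x : Fin n → Bool, C.eval x = F (fun a => (Cs a).eval x)
  · -- (v9, UNCONDITIONAL) a Boolean function of `≤ n^β` few-majority sub-circuits: the narrow-waist rung
    obtain ⟨K, hK, F, Cs, hCs, hC⟩ := hWaist
    simp only [hC]
    exact h₁₁ K hK F Cs hCs
  by_cases hPTF : ∃ (q : (Fin n → Bool) → ℝ) (b : Bool), fourierDegree q ≤ d ∧
      ∀ x : Fin n → Bool, C.eval x = xor b (decide (0 ≤ q x))
  · -- (v10, UNCONDITIONAL) a polynomial threshold function of degree `≤ d` (e.g. depth two, `MAJ` top, bottom gates of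
    -- fan-in `≤ d`; the sign of a real polynomial of degree `d` in the bits): the PTF rung (Diakonikolas–Raghavendra–Servedio–Tan)
    obtain ⟨q, b, hq, hC⟩ := hPTF
    simp only [hC]
    exact h₁₃ q hq b
  by_cases hPer : ∃ q : ℕ, 1 ≤ q ∧ q ≤ n ^ d ∧ ∃ g : ℕ → Bool, ∀ N : ℕ, N < 2 ^ n →
      C.eval (fun i : Fin n => Nat.testBit N i) = g (N % q)
  · -- (v10, UNCONDITIONAL) a circuit computing a `q`-PERIODIC function of `N`, `q ≤ n^d` (e.g. any function of
    -- `N mod q`, a depth-two `MAJ ∘ MAJ` circuit of size `O(n q)`): the periodic rung (Siegel–Walfisz for `λ`, PROVED in the tree)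
    obtain ⟨q, hq1, hqn, g, hg⟩ := hPer
    rw [Finset.sum_congr rfl fun N hN => by rw [hg N (Finset.mem_range.1 hN)]]
    exact h₁₄ q hq1 hqn (fun a => sgn (g a)) (fun a => by unfold sgn; split_ifs <;> simp)
  by_cases hd1 : C.acDepth ≤ 1
  · exact h₁ C hB hd1      -- depth one: the threshold rung (v4)
  by_cases hd2 : C.acDepth ≤ 2
  · -- depth two (v6): the normal form, then the Kane rung or the `LtfCombinationPoly` rung
    by_cases hMs : ∀ (j : ℕ) (hj : j < C.gates.length), (∃ k, (C.gates[j]).fn = GateFn.maj k) →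
        (GateList.wdepths acWeight C.gates).getD j 0 ≤ 1
    · -- every majority gate at depth ≤ 1, i.e. an `∧/∨` top gate over threshold gates: KANE (v6), syntactically
      obtain ⟨K, b, w, t, hK, hor⟩ := stub_depthTwoOrNf C hB hd2 hMs
      have hKn : K ≤ n ^ (p.natDegree + 2) := hK.trans ((Nat.add_le_add_right hs n).trans hpn)
      have h := h₅ K hKn b w t
      simp only [← hor] at h
      exact h
    obtain ⟨K, b, w, t, hK, hnf⟩ := stub_depthTwo_nf C hB hd2
    have hKn : K ≤ n ^ (p.natDegree + 2) := hK.trans ((Nat.add_le_add_right hs n).trans hpn)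
    rcases hnf with hor | ⟨μ, θ, hmaj⟩
    · -- `∧/∨` top gate: Kane's theorem (v6)
      have h := h₅ K hKn b w t
      simp only [← hor] at h
      exact h
    · by_cases hKα : (K : ℝ) ≤ (n : ℝ) ^ α
      · -- majority top gate over `≤ n^α` distinct threshold gates: `LtfCombinationPoly` (v5 support)
        have h := h₆ K hKα (fun v => xor b (decide (θ ≤ 2 * ∑ a : Fin K, μ a * (v a).toNat))) w t
        simp only [← hmaj] at h
        exact h
      · exact h₃ C hB hd hs  -- THE OPEN RESIDUE (depth two): MAJ over > n^α threshold gates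
  by_cases hA : C.IsOver acBasis
  · exact h₂ C hA hd hs    -- no majority gate: the AC⁰ rung (tree)
  by_cases hM : ∀ g ∈ C.gates, ∀ k : ℕ, g.fn = GateFn.maj k → 2 ^ k ≤ n ^ d
  · exact h₄ C hB hM hd hs -- all majority fan-ins ≤ d·log₂ n (for instance): the small-fan-in rung (v5)
  by_cases hFew : (∀ (j : ℕ) (hj : j < C.gates.length), (∃ k, 3 ≤ k ∧ (C.gates[j]).fn = GateFn.maj k) →
      (GateList.wdepths acWeight C.gates).getD j 0 ≤ 1) ∧
      (((Finset.univ.filter fun j : Fin C.gates.length =>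
          3 ≤ (C.gates[j]).arity ∧ (C.gates[j]).fn = GateFn.maj (C.gates[j]).arity).card : ℝ) ≤ c₀ * Real.log n)
  · exact h₇ C hB hd hs hFew.1 hFew.2 -- ≤ c₀ log n genuine (fan-in ≥ 3) majority gates, all at the bottom: the few-majority rung (v7)
  · exact h₃ C hB hd hs    -- THE OPEN RESIDUE (depth ≥ 3): a majority gate of fan-in > d log₂ n above the bottom, or > c₀ log n of them

end Summit.QuantumAdvantage.LiouvilleOrthogonalTC0.Sketch
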